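import Mathlib
import Literature.MathematicalPhysics.QuantumFieldTheory.Balaban1983to89.T4ConstrainedAgmon

/-!
# T4ConstrainedAgmonD — the constrained Agmon bound of the energy-convexity route to NE3 in the FOUR-DIMENSIONAL BLOCK MODEL: admissible block geometries, variance tensorisation of the block Poincaré inequality, products, and the T⁴ cubic block geometry with every constant uniform in the mesh and the volume, and (v1.1) non-finite-range tangent corrections along exponentially localised projectors, and (v1.2) localised kernel terms in the form (cell `pub-balaban`, T4-DAG node U1 (b), spine estimate NE3, row T4-U1b.NE3-PROVE-P2c*; folklore algebra + lattice bookkeeping; continuation of `T4ConstrainedAgmon` as a separate file only because of the gate's file-size limit)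

HONEST FRAMING (cell `pub-balaban`, T4-DAG PAGE 1).  The cell's T4 target is the existence AND uniqueness of the
continuum limit of Bałaban's unit-scale averaged loop expectations on a FINITE torus T⁴ — a constructive-QFT
statement strictly beyond ultraviolet stability; there is NO mass gap statement here, it is NOT the Clay problem and
NOT summit progress.  This module is kernel work of ONE technique seat (energy-convexity, P2) for the cell's NEW
ESTIMATE NE3 = "η-rate of the minimisers" (node U1 (b); NE3 is by the cell's DAG §3 free of the conditionals
BetaPertH, (B), (B^μ), and nothing below mentions them).  It continues the LOCALISATION input δ of the energy route
(`T4ConvexResponse` §8, `T4ConstrainedAgmon` §8g–§8h: `constrained_lattice_agmon_of_le`, `tangent_source_extension`,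
`coercive_of_poincare`, and the ONE-dimensional instance `constrained_lattice_agmon_1D_tangentSource`) from one to
FOUR dimensions — the dimension of the cell's torus.  EVERYTHING below is [folklore]: the block deviation functional
and its tensorisation (the Efron–Stein inequality for the uniform measure on a product of two finite sets), an
abstract notion of ADMISSIBLE BLOCK GEOMETRY on a finite abelian group closed under binary products, the verification
that the one-dimensional parabola geometry of `T4ConstrainedAgmon` is admissible, and the resulting theorem on
`(Z/(Kn))^4`.  NOTHING is asserted about Bałaban's configurations, operators or norms; every `(h… : …)` binder that
a dictionary would have to supply is named as such, and whether the dictionary holds is the paper-level content of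
the record HOME/t4/T4-EST-NE3-P2.md (items (δ1′), (δ3)–(δ5), γ, β), where the first non-following step is localised
(it is the β-side derivative-defect bound, record Appendix β / GAPS G-ne3p2-1 — untouched by this module).  Value =
kernel certificate that the mechanism «Agmon conjugation + finite-range tangent correction + block Poincaré» closes
on the four-dimensional torus with constants free of the mesh `n = η⁻¹ = L^k` and of the volume `K⁴`, and (§6, v1.1)
that finite range is not needed: an exponentially localised projector onto an ARBITRARY tangent subspace costs its
two conjugation defects, `O(ν + μ)` in the energy gauge; NOT summit progress.

CITATION HEADER (lean-in-tree rule 2026-08-18).  Source whose displayed formulas are READ as CONTEXT (never cited as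
establishing a disputed step — it is a manuscript under audit): T. Bałaban, *The variational problem and background
fields in renormalization group method for lattice gauge theories*, Commun. Math. Phys. **102** (1985) 277–309,
doi:10.1007/bf01229381 = [Balaban1985Variational] (cell paper B11, held `paper:balaban1985-cmp102-variational-
background`).  The sentences read are exactly those quoted verbatim in the header of `T4ConstrainedAgmon` — the
functional (81), the critical-point equation (82) on the tangent space "QδA′ = 0, RD*δA′ = 0. (83)" p. 290, the
fixed-point form (116) and Proposition 6 p. 295 — and, as context for WHAT THE BLOCK SUMS MODEL, the averaging
constraints (19)–(21) p. 281; §6 (v1.1) additionally READS AS CONTEXT — for what its exponentially localised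
projector is meant to model, never as a fact — the description of the operator H on p. 285 ("defined on
configurations B and giving a minimum of the quadratic form ½⟨A, Δ A⟩ under the restrictions L^j_η Q_j A = B on Λ_j,
j = 0, 1, …, k, R D* A = 0", its properties (45)–(46)) and the pseudo-locality paragraph pp. 287–289 ((63)–(73): "a
value of D(A′) at a bond c ∈ 𝔅_k depends weakly on a configuration A at bonds b far apart from c"); no further
sentence of the paper is used and none is used as a fact.
[cite: Balaban1985Variational, (81)–(84) p. 290; (116), Prop. 6 p. 295; (19)–(21) p. 281; (44)–(47) p. 285,
(63)–(73) pp. 287–289 (context only)]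

WHAT IS CELL-SUPPLIED, NOT PRINTED (never cited; enters NOWHERE below — the model's coercivity is its own theorem):
the lemma ML of HOME/b2b-balaban-b11-g5/ML-SUPPLIED.md (tangent-only strong second variation, modulus `½c_*`); in the
dictionary it is the hypothesis `hcoerT` of `constrained_lattice_agmon_of_le`, here DISCHARGED IN THE MODEL by
`Admissible.coercive` / `coercive_blockTangent_4D` (block Poincaré, modulus `1/(1+s)`).

WHAT IS PROVED (all [folklore], sorry-free).  §1 `devSq` (block deviation functional) + `devSq_eq_sum_sq_sub`,
`devSq_nonneg`, `devSq_of_sum_eq_zero`, `devSq_sum_le`, `devSq_product_eq` (exact two-factor decomposition),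
`devSq_product_le` (VARIANCE TENSORISATION: `W_{F₁×F₂}(f) ≤ Σ_{x₂} W_{F₁}(f(·,x₂)) + Σ_{x₁} W_{F₂}(f(x₁,·))`).
§2 `Admissible` (structure: fibre size, exactness, support, exit faces, sup, mesh gradient, deviation-form block
Poincaré) + `filter_mem_fiber_eq` (multiplicity one), `Admissible.energy_le` (`C_u = (Na)²(16#ι + s)`),
`Admissible.weighted_energy_le` (`C_w = (Na)²(#ι(4+μ)² + s)/(1−ϑ)`), `norm_fwdDiff_sq`, `norm_sq_eq_sum`,
`Admissible.poincare_tangent`, `Admissible.coercive` (`m = 1/(1 + sC_P)`), `Admissible.agmon_of_le`,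
`Admissible.agmon_tangentSource` (the generic assembled theorems, by `constrained_lattice_agmon_of_le` and
`tangent_source_extension`).  §3 `devSq_block_1D` (deviation-form Poincaré on `Z/(Kn)`, no constraint on `v`),
`admissible_1D` (`N = n`, `a = 3/n`, `C_P = 1`).  §4 `prodDir`, `prodBlk`, `prodProfile` (+ `_apply`,
`add_prodDir_inl/inr`, `fiber_prodBlk`), `devSq_prod_le`, `Admissible.prod` (`N₁N₂`, `a₁a₂`, SAME `C_P`).
§5 `Torus4`, `Dir4`, `Blocks4`, `dir4`, `blk4`, `theta4`, `card_Dir4`, `admissible_4D` (`N·a = 81`, `C_P = 1`),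
`block_poincare_4D`, `coercive_blockTangent_4D`, `constrained_lattice_agmon_4D_tangentSource` (the T⁴ model theorem,
constants `6561(64+s)`, `6561(4(4+μ)²+s)`, `4μ²/s`, `(1+μ√(4/s))²`, `1/(1+s)` — all free of `n`, `K`), and two
NON-VACUITY examples (explicit admissible data `(s, μ, ϑ, θ₁, θ₂)` in one and four dimensions; the first answers
remark R2 of the outside reading C-pv25g11-3 of `T4ConstrainedAgmon` v1.1).
§6 (v1.1, APPEND-ONLY; §1–§5 byte-identical to v1) NON-FINITE-RANGE TANGENT CORRECTIONS ((δ5) at model level):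
`agmon_constrained_tangent_projector` (abstract: ANY linear projector onto the tangent space supplies both
corrections, priced by its two conjugation defects `‖wPw⁻¹ − P‖`, `‖P − w⁻¹Pw‖` in the gauge),
`sq_sum_mul_le_schur`, `norm_kernelOp_sq_le` (Schur test on ℓ²(G)), `fwdDiff_kernelOp`, `energyNorm_kernelOp_le`
(Schur test in the energy gauge), `conj_kernelOp_sub_apply`, `exp_mul_sub_one_le_chord`
(`e^{νt} − 1 ≤ (ν/a)(e^{at} − 1)`, `0 ≤ ν ≤ a`), `weight_ratio_bounds`, `weight_mesh_abs_le`,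
`weight_inv_mesh_lipschitz`, `kernel_conjugationDefect_energy_le` (exponentially localised kernel + log-Lipschitz
weight ⇒ defect `Θ = O(ν + μ)` in the energy gauge, `Θ² = #ι((ν/a)C_p′ + μC_p)²/s + ((ν/a)C_p)²`),
`constrained_lattice_agmon_projector` (assembled lattice theorem for an ARBITRARY tangent subspace and projector),
`constrained_lattice_agmon_localized` (fully discharged: `θ₁ = Θ`, `θ₂ = 2Θ`) and a non-vacuity example — all
constants free of the mesh and the volume; the construction of such a projector for Bałaban's constraint space is
NOT here (dictionary (δ5), printed TYPE).
§7 (v1.2, APPEND-ONLY; §1–§6 byte-identical to v1.1) LOCALISED KERNEL TERMS IN THE FORM ((δ3) at model level):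
`kernelForm_eq_inner`, `kernelForm_abs_le` (off-diagonal Schur bound), `norm_mul_norm_le_energy`, `kernelForm_reweight`
(change of gauge `P_t(u,h) = P_{t·ω(y)/ω(x)}(ωu, ω⁻¹h)`), `kernelForm_weighted_abs_le` (`Λ_w`-contribution `C_t/s`),
`conjugationDefect_energy_of_norm`, `kernelForm_conjugationDefect_localized` (`κ`-contribution `(ν/a)C_t/s`),
`constrained_lattice_agmon_kernelTerm` (the assembled theorem for the form `B_{s₀} + P_t`, coercivity hypothesis on the
full form) and a non-vacuity example; the values of `C_t` for Bałaban's block operators are dictionary ((δ3), printed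
TYPE (80) p. 290), NOT supplied here.
Record: HOME/t4/T4-EST-NE3-P2.md (v1.14, §5 (5.3‴) the four-dimensional block model; v1.15, (5.3⁗) §6; v1.16, §7).
-/

noncomputable section

open Finset
open Literature.MathematicalPhysics.QuantumFieldTheory.Balaban1983to89.T4ConvexResponse
open Literature.MathematicalPhysics.QuantumFieldTheory.Balaban1983to89.T4ConvexResponse.LatticeWitness
open Literature.MathematicalPhysics.QuantumFieldTheory.Balaban1983to89.T4ConstrainedAgmon

namespace Literature.MathematicalPhysics.QuantumFieldTheory.Balaban1983to89.T4ConstrainedAgmonD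

/-! ## §1 The block deviation functional `devSq` (sum of squared deviations from the block mean) and its
sub-additivity over the two factors of a product block (variance tensorisation). -/

section DevSq

variable {α β : Type*}

/-- Sum of squared deviations from the mean over a finite set: `W_F(g) = Σ_F g² − (Σ_F g)²/#F`
(= `Σ_F (g − ḡ)²`, `devSq_eq_sum_sq_sub`; for `#F = 0` it is `0`). [folklore] -/
def devSq (F : Finset α) (g : α → ℝ) : ℝ := ∑ x ∈ F, g x ^ 2 - (∑ x ∈ F, g x) ^ 2 / F.card

/-- `W_F(g) = Σ_{x∈F} (g x − (Σ_F g)/#F)²` for `F` non-empty. [folklore] -/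
theorem devSq_eq_sum_sq_sub (F : Finset α) (hF : F.Nonempty) (g : α → ℝ) :
    devSq F g = ∑ x ∈ F, (g x - (∑ y ∈ F, g y) / F.card) ^ 2 := by
  have hc : (0:ℝ) < F.card := by exact_mod_cast hF.card_pos
  unfold devSq
  have : ∑ x ∈ F, (g x - (∑ y ∈ F, g y) / F.card) ^ 2 =
      ∑ x ∈ F, g x ^ 2 - 2 * ((∑ y ∈ F, g y) / F.card) * ∑ x ∈ F, g x
        + F.card * ((∑ y ∈ F, g y) / F.card) ^ 2 := by
    simp only [sub_sq, Finset.sum_add_distrib, Finset.sum_sub_distrib, Finset.sum_const, nsmul_eq_mul,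
      Finset.mul_sum]
    refine congrArg₂ _ (congrArg₂ _ rfl (Finset.sum_congr rfl fun x _ => by ring)) rfl
  rw [this]
  field_simp
  ring

/-- `0 ≤ W_F(g)`. [folklore] -/
theorem devSq_nonneg (F : Finset α) (g : α → ℝ) : 0 ≤ devSq F g := by
  rcases F.eq_empty_or_nonempty with h | h
  · simp [devSq, h]
  · rw [devSq_eq_sum_sq_sub F h]; exact Finset.sum_nonneg fun _ _ => sq_nonneg _

/-- If `Σ_F g = 0` then `W_F(g) = Σ_F g²`. [folklore] -/
theorem devSq_of_sum_eq_zero (F : Finset α) (g : α → ℝ) (h : ∑ x ∈ F, g x = 0) :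
    devSq F g = ∑ x ∈ F, g x ^ 2 := by
  simp [devSq, h]

/-- SUB-ADDITIVITY UNDER SUMS OF FUNCTIONS (convexity of the quadratic form `W_F`): for a finite family `u_k`,
`W_F(Σ_k u_k) ≤ #K · Σ_k W_F(u_k)` (sitewise Cauchy–Schwarz on the centred functions). [folklore] -/
theorem devSq_sum_le (F : Finset α) (T : Finset β) (u : β → α → ℝ) :
    devSq F (fun x => ∑ k ∈ T, u k x) ≤ T.card * ∑ k ∈ T, devSq F (u k) := by
  rcases F.eq_empty_or_nonempty with h | h
  · simp [devSq, h]
  rw [devSq_eq_sum_sq_sub F h]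
  simp_rw [devSq_eq_sum_sq_sub F h]
  have hcen : ∀ x ∈ F, (∑ k ∈ T, u k x) - (∑ y ∈ F, ∑ k ∈ T, u k y) / F.card =
      ∑ k ∈ T, (u k x - (∑ y ∈ F, u k y) / F.card) := by
    intro x _
    rw [Finset.sum_comm, Finset.sum_sub_distrib, Finset.sum_div]
  rw [Finset.sum_congr rfl fun x hx => by rw [hcen x hx]]
  calc ∑ x ∈ F, (∑ k ∈ T, (u k x - (∑ y ∈ F, u k y) / F.card)) ^ 2
      ≤ ∑ x ∈ F, (T.card * ∑ k ∈ T, (u k x - (∑ y ∈ F, u k y) / F.card) ^ 2) :=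
        Finset.sum_le_sum fun x _ => sq_sum_le_card_mul_sum_sq
    _ = T.card * ∑ k ∈ T, ∑ x ∈ F, (u k x - (∑ y ∈ F, u k y) / F.card) ^ 2 := by
        rw [← Finset.mul_sum, Finset.sum_comm]

/-- EXACT TWO-FACTOR DECOMPOSITION: on a product block `F₁ ×ˢ F₂`,
`W_{F₁×F₂}(f) = Σ_{x₂∈F₂} W_{F₁}(f(·,x₂)) + (1/#F₁)·W_{F₂}(x₂ ↦ Σ_{x₁∈F₁} f(x₁,x₂))`. [folklore] -/
theorem devSq_product_eq (F₁ : Finset α) (F₂ : Finset β) (hF₁ : F₁.Nonempty) (f : α × β → ℝ) :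
    devSq (F₁ ×ˢ F₂) f = ∑ x₂ ∈ F₂, devSq F₁ (fun x₁ => f (x₁, x₂))
      + (1 / F₁.card) * devSq F₂ (fun x₂ => ∑ x₁ ∈ F₁, f (x₁, x₂)) := by
  have hc : (0:ℝ) < F₁.card := by exact_mod_cast hF₁.card_pos
  unfold devSq
  rw [Finset.card_product, Nat.cast_mul, Finset.sum_product_right, Finset.sum_product_right,
    Finset.sum_sub_distrib, ← Finset.sum_div]
  field_simp
  ring

/-- VARIANCE TENSORISATION (Efron–Stein sub-additivity on a product of two finite sets): 
`W_{F₁×F₂}(f) ≤ Σ_{x₂∈F₂} W_{F₁}(f(·,x₂)) + Σ_{x₁∈F₁} W_{F₂}(f(x₁,·))` — the sum of squared deviations from the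
block mean is at most the sum over all coordinate LINES of the squared deviations from the line means.  This is what
makes the block Poincaré constant STABLE UNDER PRODUCTS (`Admissible.prod`: C_P = max, not sum). [folklore] -/
theorem devSq_product_le (F₁ : Finset α) (F₂ : Finset β) (f : α × β → ℝ) :
    devSq (F₁ ×ˢ F₂) f ≤ ∑ x₂ ∈ F₂, devSq F₁ (fun x₁ => f (x₁, x₂))
      + ∑ x₁ ∈ F₁, devSq F₂ (fun x₂ => f (x₁, x₂)) := by
  rcases F₁.eq_empty_or_nonempty with h1 | h1
  · simp [devSq, h1]
  have hc : (0:ℝ) < F₁.card := by exact_mod_cast h1.card_pos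
  rw [devSq_product_eq F₁ F₂ h1 f]
  refine add_le_add le_rfl ?_
  have hsub := devSq_sum_le F₂ F₁ (fun x₁ x₂ => f (x₁, x₂))
  rw [one_div, inv_mul_le_iff₀ hc]
  simpa using hsub

end DevSq

/-! ## §2 ADMISSIBLE BLOCK GEOMETRIES: the data (directions `e`, block map `blk`, profile family `θ`) and the
seven properties the generic assembled theorems consume, with fibre size `N`, profile height `a` (mesh gradient
`≤ 4a`) and block Poincaré constant `C_P`. -/

section AdmissibleDefs

variable {G : Type*} [AddCommGroup G] [Fintype G] [DecidableEq G] {ι : Type*} [Fintype ι]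
  {Bk : Type*} [Fintype Bk] [DecidableEq Bk]

/-- ADMISSIBLE BLOCK GEOMETRY on a finite abelian group `G` with mesh rescaling `c`, lattice directions `e`, block map
`blk` and profile family `θ`: every block has `N` sites; `θ` is an exact right inverse of the block-sum map
(`ProfileExact`), `θ_b` and its forward shifts vanish off block `b` (`support`), `θ_b` vanishes at every exit face
(`exit`: `x ∈ b`, `x + e_i ∉ b ⇒ θ_b x = 0`), `|θ_b| ≤ a`, `|c∇_iθ_b| ≤ 4a`; and the BLOCK POINCARÉ INEQUALITY in
deviation form, `W_b(v) ≤ C_P Σ_i Σ_{x∈b} (c(v(x+e_i) − v(x)))²` for every real function `v` (all bonds starting in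
the block; no constraint on `v`).  Instances: the 1D parabola geometry on `Z/(Kn)` (`admissible_1D`: `N = n`,
`a = 3/n`, `C_P = 1`) and PRODUCTS (`Admissible.prod`: `N = N₁N₂`, `a = a₁a₂`, the SAME `C_P`), hence the cubic block
geometry of `(Z/(Kn))^4` (`admissible_4D`: `N·a = 81`, `C_P = 1`).  Dictionary: `n = L^k = η⁻¹`, blocks = unit cubes,
`T_Q = ker Q_k` (plain block averages; the covariant average (19) differs by transports, not modelled). [folklore]
[cite: Balaban1985Variational, (19)–(21) p. 281 (context: the averaging constraint modelled by the block sums)] -/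
structure Admissible (c : ℝ) (e : ι → G) (blk : G → Bk) (θ : Bk → EuclideanSpace ℝ G) (N : ℕ) (a CP : ℝ) :
    Prop where
  N_pos : 0 < N
  card_fiber : ∀ b, (fiber blk b).card = N
  profileExact : ProfileExact blk θ
  support : ∀ b x, x ∉ fiber blk b → θ b x = 0 ∧ ∀ i, θ b (x + e i) = 0
  exit : ∀ b x i, x ∈ fiber blk b → x + e i ∉ fiber blk b → θ b x = 0
  profile_abs_le : ∀ b x, |θ b x| ≤ a
  profile_diff_le : ∀ b i x, |c * (θ b (x + e i) - θ b x)| ≤ 4 * a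
  CP_nonneg : 0 ≤ CP
  poincare : ∀ b (v : G → ℝ), devSq (fiber blk b) v ≤
    CP * ∑ i, ∑ x ∈ fiber blk b, (c * (v (x + e i) - v x)) ^ 2

omit [AddCommGroup G] in
/-- Blocks are disjoint: a site lies in exactly one block (multiplicity `M = 1` for in-block profile families).
[folklore] -/
theorem filter_mem_fiber_eq (blk : G → Bk) (x : G) :
    (Finset.univ.filter (fun b => x ∈ fiber blk b)) = {blk x} := by
  ext b; simp [mem_fiber, eq_comm]

variable {c : ℝ} {e : ι → G} {blk : G → Bk} {θ : Bk → EuclideanSpace ℝ G} {N : ℕ} {a CP : ℝ}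

omit [DecidableEq G] [Fintype Bk] in
/-- The profile height is non-negative. [folklore] -/
theorem Admissible.a_nonneg (hA : Admissible c e blk θ N a CP) : 0 ≤ a :=
  (abs_nonneg _).trans (hA.profile_abs_le (blk 0) 0)

omit [DecidableEq G] [Fintype Bk] in
/-- PROFILE ENERGY of an admissible geometry (hypothesis `hP2u` of the generic theorems):
`#b · N_s(θ_b)² ≤ (N a)²(16·#ι + s)` (`energyNorm_sq_le_of_support` with `#S = N`, sup `a`, mesh gradient `4a`).
[folklore] -/
theorem Admissible.energy_le (hA : Admissible c e blk θ N a CP) {s : ℝ} (hs : 0 ≤ s) (b : Bk) :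
    ((fiber blk b).card : ℝ) * energyNorm c e s (θ b) ^ 2 ≤ (N * a) ^ 2 * (16 * Fintype.card ι + s) := by
  have hE := energyNorm_sq_le_of_support c e hs (θ b) (fiber blk b) (a := a) (ℓ := 4 * a) (hA.support b)
    (hA.profile_abs_le b) (fun i x => hA.profile_diff_le b i x)
  rw [hA.card_fiber b] at hE ⊢
  have hN : (0:ℝ) ≤ N := Nat.cast_nonneg N
  calc (N : ℝ) * energyNorm c e s (θ b) ^ 2 ≤ N * (N * (Fintype.card ι * (4 * a) ^ 2 + s * a ^ 2)) :=
        mul_le_mul_of_nonneg_left hE hN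
    _ = (N * a) ^ 2 * (16 * Fintype.card ι + s) := by ring

omit [DecidableEq G] [Fintype Bk] in
/-- WEIGHTED PROFILE ENERGY of an admissible geometry (hypothesis `hP2w`): for a positive weight with
`|c∇_iω| ≤ μω` at the far end of every bond and block near-constancy `|ω² − ω̄_b²| ≤ ϑω̄_b²` (`0 ≤ ϑ < 1`),
`#b · ω̄_b² · N_s(ω⁻¹θ_b)² ≤ (N a)²(#ι(4 + μ)² + s)/(1 − ϑ)` — on block `b`, `ω⁻¹ ≤ 1/(ω̄_b√(1−ϑ))`
(`weight_block_compare`); Leibniz rule on bonds inside the block, and on a bond leaving the block BOTH ends of `θ_b`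
vanish (`exit`, `support`). [folklore] -/
theorem Admissible.weighted_energy_le (hA : Admissible c e blk θ N a CP) {s μ ϑ : ℝ} (hs : 0 ≤ s) (hμ : 0 ≤ μ)
    (ω : G → ℝ) (hpos : ∀ x, 0 < ω x)
    (hω : ∀ i x, c ^ 2 * (ω (x + e i) - ω x) ^ 2 ≤ μ ^ 2 * ω x ^ 2 ∧
      c ^ 2 * (ω (x + e i) - ω x) ^ 2 ≤ μ ^ 2 * ω (x + e i) ^ 2)
    (ωbar : Bk → ℝ) (hωbar : ∀ b, 0 < ωbar b) (hϑ : 0 ≤ ϑ) (hϑ1 : ϑ < 1)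
    (hW1 : ∀ x, |ω x ^ 2 - ωbar (blk x) ^ 2| ≤ ϑ * ωbar (blk x) ^ 2) (b : Bk) :
    ((fiber blk b).card : ℝ) * ωbar b ^ 2 *
      energyNorm c e s (mulOp (fun x => (ω x)⁻¹) (θ b)) ^ 2 ≤
        (N * a) ^ 2 * (Fintype.card ι * (4 + μ) ^ 2 + s) / (1 - ϑ) := by
  have ha := hA.a_nonneg
  have h1ϑ : 0 < 1 - ϑ := by linarith
  have hsq : 0 < Real.sqrt (1 - ϑ) := Real.sqrt_pos.mpr h1ϑ
  set Γ : ℝ := 1 / (ωbar b * Real.sqrt (1 - ϑ)) with hΓ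
  have hΓ0 : 0 ≤ Γ := by have := (hωbar b).le; positivity
  have hinv : ∀ x, x ∈ fiber blk b → (ω x)⁻¹ ≤ Γ := by
    intro x hx
    rw [mem_fiber] at hx
    have hwc := (weight_block_compare (hpos x) (hωbar (blk x)) hϑ hϑ1 (hW1 x)).2
    rw [hx] at hwc
    rw [hΓ, inv_eq_one_div]
    exact one_div_le_one_div_of_le (by have := hωbar b; positivity) hwc
  set F := mulOp (fun x => (ω x)⁻¹) (θ b) with hF
  have hFx : ∀ x, F x = (ω x)⁻¹ * θ b x := fun x => by simp [hF, mulOp_apply]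
  have hsupp : ∀ x, x ∉ fiber blk b → F x = 0 ∧ ∀ i, F (x + e i) = 0 := by
    intro x hx
    have := hA.support b x hx
    exact ⟨by rw [hFx, this.1, mul_zero], fun i => by rw [hFx, this.2 i, mul_zero]⟩
  have hsup : ∀ x, |F x| ≤ Γ * a := by
    intro x
    rw [hFx]
    by_cases hb : x ∈ fiber blk b
    · rw [abs_mul, abs_of_pos (inv_pos.mpr (hpos x))]
      exact mul_le_mul (hinv x hb) (hA.profile_abs_le b x) (abs_nonneg _) hΓ0
    · rw [(hA.support b x hb).1, mul_zero, abs_zero]; positivity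
  have hℓ : ∀ i x, |c * (F (x + e i) - F x)| ≤ (4 + μ) * Γ * a := by
    intro i x
    have hpos0 := hpos x
    have hpos1 := hpos (x + e i)
    by_cases hb : x ∈ fiber blk b
    · by_cases hb1 : x + e i ∈ fiber blk b
      · have hdi : |c * ((ω (x + e i))⁻¹ - (ω x)⁻¹)| ≤ μ * Γ := by
          have e1 : c * ((ω (x + e i))⁻¹ - (ω x)⁻¹) =
              -(c * (ω (x + e i) - ω x)) * ((ω x)⁻¹ * (ω (x + e i))⁻¹) := by
            field_simp; ring
          have hnum : |c * (ω (x + e i) - ω x)| ≤ μ * ω (x + e i) := by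
            have : (c * (ω (x + e i) - ω x)) ^ 2 ≤ (μ * ω (x + e i)) ^ 2 := by
              rw [mul_pow, mul_pow]; exact (hω i x).2
            exact abs_le.mpr (abs_le_of_sq_le_sq' this (by positivity))
          rw [e1, abs_mul, abs_neg, abs_of_pos (by positivity : (0:ℝ) < (ω x)⁻¹ * (ω (x + e i))⁻¹)]
          calc |c * (ω (x + e i) - ω x)| * ((ω x)⁻¹ * (ω (x + e i))⁻¹)
              ≤ μ * ω (x + e i) * ((ω x)⁻¹ * (ω (x + e i))⁻¹) :=
                mul_le_mul_of_nonneg_right hnum (by positivity)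
            _ = μ * (ω x)⁻¹ := by field_simp
            _ ≤ μ * Γ := mul_le_mul_of_nonneg_left (hinv x hb) hμ
        have heq : c * (F (x + e i) - F x) =
            (ω (x + e i))⁻¹ * (c * (θ b (x + e i) - θ b x))
            + (c * ((ω (x + e i))⁻¹ - (ω x)⁻¹)) * θ b x := by
          rw [hFx, hFx]; ring
        rw [heq]
        calc |(ω (x + e i))⁻¹ * (c * (θ b (x + e i) - θ b x))
              + (c * ((ω (x + e i))⁻¹ - (ω x)⁻¹)) * θ b x|
            ≤ |(ω (x + e i))⁻¹ * (c * (θ b (x + e i) - θ b x))|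
              + |(c * ((ω (x + e i))⁻¹ - (ω x)⁻¹)) * θ b x| := abs_add_le _ _
          _ ≤ Γ * (4 * a) + μ * Γ * a := by
              refine add_le_add ?_ ?_
              · rw [abs_mul, abs_of_pos (inv_pos.mpr hpos1)]
                exact mul_le_mul (hinv (x + e i) hb1) (hA.profile_diff_le b i x) (abs_nonneg _) hΓ0
              · rw [abs_mul]
                exact mul_le_mul hdi (hA.profile_abs_le b x) (abs_nonneg _) (by positivity)
          _ = (4 + μ) * Γ * a := by ring
      · -- the bond leaves the block: both ends of θ_b vanish
        have hx0 : θ b x = 0 := hA.exit b x i hb hb1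
        have hx1 : θ b (x + e i) = 0 := (hA.support b (x + e i) hb1).1
        rw [hFx, hFx, hx0, hx1]; simp; positivity
    · have hs' := hsupp x hb
      rw [hs'.1, hs'.2 i]; simp; positivity
  have hE := energyNorm_sq_le_of_support c e hs F (fiber blk b) hsupp hsup hℓ
  rw [hA.card_fiber b] at hE ⊢
  have hΓ2 : ωbar b ^ 2 * Γ ^ 2 = 1 / (1 - ϑ) := by
    rw [hΓ, div_pow, mul_pow, Real.sq_sqrt h1ϑ.le]
    have := (hωbar b).ne'
    field_simp
  have hN : (0:ℝ) ≤ N := Nat.cast_nonneg N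
  calc (N : ℝ) * ωbar b ^ 2 * energyNorm c e s F ^ 2
      ≤ (N : ℝ) * ωbar b ^ 2 * (N * (Fintype.card ι * ((4 + μ) * Γ * a) ^ 2 + s * (Γ * a) ^ 2)) :=
        mul_le_mul_of_nonneg_left hE (by positivity)
    _ = ωbar b ^ 2 * Γ ^ 2 * ((N * a) ^ 2 * (Fintype.card ι * (4 + μ) ^ 2 + s)) := by ring
    _ = (N * a) ^ 2 * (Fintype.card ι * (4 + μ) ^ 2 + s) / (1 - ϑ) := by rw [hΓ2]; ring

omit [DecidableEq G] [Fintype ι] in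
/-- The squared ℓ²-norm of the forward difference quotient is the bond sum. [folklore] -/
theorem norm_fwdDiff_sq (c : ℝ) (e : ι → G) (i : ι) (v : EuclideanSpace ℝ G) :
    ‖fwdDiff c e i v‖ ^ 2 = ∑ x, (c * (v (x + e i) - v x)) ^ 2 := by
  rw [EuclideanSpace.norm_eq, Real.sq_sqrt (Finset.sum_nonneg fun _ _ => sq_nonneg _)]
  simp only [Real.norm_eq_abs, sq_abs, fwdDiff_apply]

omit [AddCommGroup G] [DecidableEq G] in
/-- The squared ℓ²-norm is the site sum. [folklore] -/
theorem norm_sq_eq_sum (v : EuclideanSpace ℝ G) : ‖v‖ ^ 2 = ∑ x, v x ^ 2 := by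
  rw [EuclideanSpace.norm_eq, Real.sq_sqrt (Finset.sum_nonneg fun _ _ => sq_nonneg _)]
  simp only [Real.norm_eq_abs, sq_abs]

omit [DecidableEq G] in
/-- BLOCK POINCARÉ ON THE TANGENT SPACE from the deviation form: for `v ∈ T_Q` (zero block sums) the deviation
functional of each block is the plain block sum of squares, so `‖v‖² ≤ C_P Σ_i ‖c∇_i v‖²`. [folklore] -/
theorem Admissible.poincare_tangent (hA : Admissible c e blk θ N a CP) (v : EuclideanSpace ℝ G)
    (hv : v ∈ blockTangent blk) : ‖v‖ ^ 2 ≤ CP * ∑ i, ‖fwdDiff c e i v‖ ^ 2 := by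
  have hfib : ∀ f : G → ℝ, ∑ x, f x = ∑ b, ∑ x ∈ fiber blk b, f x := fun f =>
    (Finset.sum_fiberwise Finset.univ blk f).symm
  rw [norm_sq_eq_sum]
  simp_rw [norm_fwdDiff_sq]
  rw [hfib (fun x => v x ^ 2)]
  have hrhs : CP * ∑ i, ∑ x, (c * (v (x + e i) - v x)) ^ 2 =
      ∑ b, CP * ∑ i, ∑ x ∈ fiber blk b, (c * (v (x + e i) - v x)) ^ 2 := by
    have h1 : ∀ i, ∑ x, (c * (v (x + e i) - v x)) ^ 2 =
        ∑ b, ∑ x ∈ fiber blk b, (c * (v (x + e i) - v x)) ^ 2 :=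
      fun i => hfib (fun x => (c * (v (x + e i) - v x)) ^ 2)
    simp_rw [h1]
    rw [Finset.sum_comm, Finset.mul_sum]
  rw [hrhs]
  refine Finset.sum_le_sum fun b _ => ?_
  have hb := (mem_blockTangent.mp hv) b
  rw [blockSum_apply] at hb
  have hdev := devSq_of_sum_eq_zero (fiber blk b) (fun x => v x) hb
  change ∑ x ∈ fiber blk b, v x ^ 2 ≤ _
  rw [← hdev]
  exact hA.poincare b (fun x => v x)

omit [DecidableEq G] in
/-- TANGENT-ONLY COERCIVITY of an admissible geometry: for all `0 ≤ s₀`, `0 ≤ s` (in particular the MASSLESS form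
`s₀ = 0`), `(1/(1 + s·C_P))·N_s(v)² ≤ B_{s₀}(v,v)` on `T_Q` (`coercive_of_poincare`). [folklore] -/
theorem Admissible.coercive (hA : Admissible c e blk θ N a CP) {s₀ s : ℝ} (hs₀ : 0 ≤ s₀) (hs : 0 ≤ s) :
    ∀ v ∈ blockTangent blk, 1 / (1 + s * CP) * energyNorm c e s v ^ 2 ≤ latticeForm c e s₀ v v :=
  coercive_of_poincare c e hs₀ hs hA.CP_nonneg (blockTangent blk) (fun v hv => hA.poincare_tangent v hv)

/-- GENERIC ASSEMBLED THEOREM FOR AN ADMISSIBLE GEOMETRY, sub-mass / massless form, tangent-only coercivity, source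
bounded in the weighted dual gauge on ALL test fields ((δ2′) of the record): `constrained_lattice_agmon_of_le` with
the admissible profile family (multiplicity 1, `C_u = (Na)²(16#ι + s)`, `C_w = (Na)²(#ι(4+μ)² + s)/(1−ϑ)`) and
`m = 1/(1 + sC_P)` (`Admissible.coercive`).  Every constant depends on `(#ι, N·a, C_P, s, μ, ϑ)` only. [folklore]
[cite: Balaban1985Variational, (79)–(84) p. 290, (115) p. 294, (116)–(117) p. 295 (context)] -/
theorem Admissible.agmon_of_le (hA : Admissible c e blk θ N a CP) {s₀ s μ ϑ θ₁ θ₂ ρ : ℝ} (hs : 0 < s)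
    (hs₀ : 0 ≤ s₀) (hs₀s : s₀ ≤ s) (hμ : 0 ≤ μ)
    (ω : G → ℝ) (hpos : ∀ x, 0 < ω x)
    (hω : ∀ i x, c ^ 2 * (ω (x + e i) - ω x) ^ 2 ≤ μ ^ 2 * ω x ^ 2 ∧
      c ^ 2 * (ω (x + e i) - ω x) ^ 2 ≤ μ ^ 2 * ω (x + e i) ^ 2)
    (ωbar : Bk → ℝ) (hωbar : ∀ b, 0 < ωbar b) (hϑ : 0 ≤ ϑ) (hϑ1 : ϑ < 1)
    (hW1 : ∀ x, |ω x ^ 2 - ωbar (blk x) ^ 2| ≤ ϑ * ωbar (blk x) ^ 2)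
    (hθ₁0 : 0 ≤ θ₁) (hθ₁1 : θ₁ ≤ 1) (hθ₂0 : 0 ≤ θ₂)
    (hθ₁ : ϑ ^ 2 / (1 - ϑ) * ((N * a) ^ 2 * (16 * Fintype.card ι + s)) / s ≤ θ₁ ^ 2)
    (hθ₂ : ϑ ^ 2 / (1 - ϑ) ^ 2 * ((N * a) ^ 2 * (Fintype.card ι * (4 + μ) ^ 2 + s)) / s ≤ θ₂ ^ 2)
    (hden : Fintype.card ι * μ ^ 2 / s + (1 + μ * Real.sqrt (Fintype.card ι / s)) ^ 2 * θ₂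
      + θ₁ * (2 + θ₁) < 1 / (1 + s * CP) * (1 - θ₁) ^ 2)
    {u : EuclideanSpace ℝ G} (hu : u ∈ blockTangent blk) (J : EuclideanSpace ℝ G →ₗ[ℝ] ℝ) (hρ : 0 ≤ ρ)
    (hweak : ∀ v ∈ blockTangent blk, latticeForm c e s₀ u v = J v)
    (hJ : ∀ v, |J (mulOp ω v)| ≤ ρ * energyNorm c e s v) :
    energyNorm c e s (mulOp ω u) ≤ (ρ + ρ * θ₂) /
      (1 / (1 + s * CP) * (1 - θ₁) ^ 2 - θ₁ * (2 + θ₁) - Fintype.card ι * μ ^ 2 / s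
        - (1 + μ * Real.sqrt (Fintype.card ι / s)) ^ 2 * θ₂) := by
  have h1ϑ : 0 < 1 - ϑ := by linarith
  have hCP := hA.CP_nonneg
  have key := constrained_lattice_agmon_of_le c e hs ω hpos hμ hω blk ωbar hωbar hϑ hϑ1 hW1 θ hA.profileExact
    (fun b => fiber blk b) (Mu := 1) hA.support (fun x => by rw [filter_mem_fiber_eq]; simp)
    (Cu := (N * a) ^ 2 * (16 * Fintype.card ι + s))
    (Cw := (N * a) ^ 2 * (Fintype.card ι * (4 + μ) ^ 2 + s) / (1 - ϑ)) (by positivity) (by positivity)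
    (hA.energy_le hs.le) (hA.weighted_energy_le hs.le hμ ω hpos hω ωbar hωbar hϑ hϑ1 hW1)
    hθ₁0 hθ₁1 hθ₂0
    (by rw [Nat.cast_one, one_mul]; exact hθ₁)
    (by
      rw [Nat.cast_one, one_mul]
      have h1 : (1 - ϑ) ≠ 0 := h1ϑ.ne'
      calc ϑ ^ 2 / (1 - ϑ) * ((N * a) ^ 2 * (Fintype.card ι * (4 + μ) ^ 2 + s) / (1 - ϑ)) / s
          = ϑ ^ 2 / (1 - ϑ) ^ 2 * ((N * a) ^ 2 * (Fintype.card ι * (4 + μ) ^ 2 + s)) / s := by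
            field_simp
        _ ≤ θ₂ ^ 2 := hθ₂)
    hs₀ hs₀s (m := 1 / (1 + s * CP)) (by positivity) (hA.coercive hs₀ hs.le) hden hu J hρ hweak hJ
  exact key

/-- GENERIC ASSEMBLED THEOREM WITH A TANGENT-ONLY SOURCE BOUND ((δ1′)+(δ2′) for an admissible geometry): as
`Admissible.agmon_of_le`, but the source is bounded ONLY on tangent test fields in the dual weighted gauge,
`|J φ| ≤ ρ·N(ω⁻¹φ)` for `φ ∈ T_Q`; conclusion with `ρ′ = ρ(1 + √((1+ϑ)C_w/s))` (`tangent_source_extension` with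
the admissible profiles, multiplicity 1).  Dictionary: massless fluctuation form, averaging constraint, Agmon weight,
source tested on tangent fields only — in ANY admissible geometry, in particular the cubic block geometry of the
four-dimensional torus (`constrained_lattice_agmon_4D_tangentSource`). [folklore]
[cite: Balaban1985Variational, (79)–(84) p. 290, (115) p. 294, (116)–(117) p. 295 (context)] -/
theorem Admissible.agmon_tangentSource (hA : Admissible c e blk θ N a CP) {s₀ s μ ϑ θ₁ θ₂ ρ : ℝ}
    (hs : 0 < s) (hs₀ : 0 ≤ s₀) (hs₀s : s₀ ≤ s) (hμ : 0 ≤ μ)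
    (ω : G → ℝ) (hpos : ∀ x, 0 < ω x)
    (hω : ∀ i x, c ^ 2 * (ω (x + e i) - ω x) ^ 2 ≤ μ ^ 2 * ω x ^ 2 ∧
      c ^ 2 * (ω (x + e i) - ω x) ^ 2 ≤ μ ^ 2 * ω (x + e i) ^ 2)
    (ωbar : Bk → ℝ) (hωbar : ∀ b, 0 < ωbar b) (hϑ : 0 ≤ ϑ) (hϑ1 : ϑ < 1)
    (hW1 : ∀ x, |ω x ^ 2 - ωbar (blk x) ^ 2| ≤ ϑ * ωbar (blk x) ^ 2)
    (hθ₁0 : 0 ≤ θ₁) (hθ₁1 : θ₁ ≤ 1) (hθ₂0 : 0 ≤ θ₂)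
    (hθ₁ : ϑ ^ 2 / (1 - ϑ) * ((N * a) ^ 2 * (16 * Fintype.card ι + s)) / s ≤ θ₁ ^ 2)
    (hθ₂ : ϑ ^ 2 / (1 - ϑ) ^ 2 * ((N * a) ^ 2 * (Fintype.card ι * (4 + μ) ^ 2 + s)) / s ≤ θ₂ ^ 2)
    (hden : Fintype.card ι * μ ^ 2 / s + (1 + μ * Real.sqrt (Fintype.card ι / s)) ^ 2 * θ₂
      + θ₁ * (2 + θ₁) < 1 / (1 + s * CP) * (1 - θ₁) ^ 2)
    {u : EuclideanSpace ℝ G} (hu : u ∈ blockTangent blk) (J : EuclideanSpace ℝ G →ₗ[ℝ] ℝ) (hρ : 0 ≤ ρ)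
    (hweak : ∀ v ∈ blockTangent blk, latticeForm c e s₀ u v = J v)
    (hJT : ∀ φ ∈ blockTangent blk, |J φ| ≤ ρ * energyNorm c e s (mulOp (fun x => (ω x)⁻¹) φ)) :
    energyNorm c e s (mulOp ω u) ≤
      (ρ * (1 + Real.sqrt ((1 + ϑ) * ((N * a) ^ 2 * (Fintype.card ι * (4 + μ) ^ 2 + s) / (1 - ϑ)) / s))
        * (1 + θ₂)) /
      (1 / (1 + s * CP) * (1 - θ₁) ^ 2 - θ₁ * (2 + θ₁) - Fintype.card ι * μ ^ 2 / s
        - (1 + μ * Real.sqrt (Fintype.card ι / s)) ^ 2 * θ₂) := by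
  have h1ϑ : 0 < 1 - ϑ := by linarith
  set Cw : ℝ := (N * a) ^ 2 * (Fintype.card ι * (4 + μ) ^ 2 + s) / (1 - ϑ) with hCw
  have hCw0 : 0 ≤ Cw := by positivity
  obtain ⟨hagree, hbound⟩ := tangent_source_extension c e hs blk θ hA.profileExact (fun b => fiber blk b) (Mu := 1)
    hA.support (fun x => by rw [filter_mem_fiber_eq]; simp) ω hpos ωbar hωbar hϑ hW1 hCw0
    (hA.weighted_energy_le hs.le hμ ω hpos hω ωbar hωbar hϑ hϑ1 hW1) J hρ hJT
  set ρ' : ℝ := ρ * (1 + Real.sqrt ((1 + ϑ) * Cw / s)) with hρ'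
  have hρ'0 : 0 ≤ ρ' := by positivity
  have key := hA.agmon_of_le hs hs₀ hs₀s hμ ω hpos hω ωbar hωbar hϑ hϑ1 hW1 hθ₁0 hθ₁1 hθ₂0 hθ₁ hθ₂ hden hu
    (J ∘ₗ tangentProj blk θ) hρ'0
    (fun v hv => by rw [hagree v hv]; exact hweak v hv)
    (fun v => by
      have := hbound (mulOp ω v)
      rw [mulOp_inv_mul ω hpos, Nat.cast_one, one_mul] at this
      exact this)
  have hnum : ρ' + ρ' * θ₂ = ρ * (1 + Real.sqrt ((1 + ϑ) * Cw / s)) * (1 + θ₂) := by rw [hρ']; ring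
  rw [hnum] at key
  exact key

end AdmissibleDefs

/-! ## §3 The one-dimensional parabola geometry on `Z/(Kn)` is admissible (`N = n`, `a = 3/n`, `C_P = 1`). -/

section OneD

variable {K n : ℕ} [NeZero K] [NeZero n]

/-- BLOCK POINCARÉ IN DEVIATION FORM on `Z/(Kn)`: for EVERY real function `v` and every block `b`,
`Σ_{x∈b}(v − v̄_b)² ≤ Σ_{x∈b} (n(v(x+1) − v(x)))²` (`poincare_range` applied to `v − v̄_b` along the block; only the
`n − 1` interior bonds are needed, the exit bond is added for free).  Unlike `block_poincare_1D` no constraint on `v`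
is assumed — this is the form that tensorises (`Admissible.prod`). [folklore] -/
theorem devSq_block_1D (h1n : 1 < n) (b : Fin K) (v : Fin (K * n) → ℝ) :
    devSq (fiber (Fin.divNat : Fin (K * n) → Fin K) b) v ≤
      1 * ∑ _i : Fin 1, ∑ x ∈ fiber (Fin.divNat : Fin (K * n) → Fin K) b,
        ((n : ℝ) * (v (x + 1) - v x)) ^ 2 := by
  have hKn : 1 < K * n := lt_of_lt_of_le h1n (Nat.le_mul_of_pos_left n (NeZero.pos K))
  rw [one_mul, Fin.sum_univ_one]
  have hne : (fiber (Fin.divNat : Fin (K * n) → Fin K) b).Nonempty := by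
    rw [← Finset.card_pos, card_fiber_divNat]; omega
  rw [devSq_eq_sum_sq_sub _ hne, card_fiber_divNat]
  simp only [sum_fiber_divNat]
  set m : ℝ := (∑ j : Fin n, v (finProdFinEquiv (b, j))) / n with hm
  set g : ℕ → ℝ := fun l => if h : l < n then v (finProdFinEquiv (b, (⟨l, h⟩ : Fin n))) - m else 0 with hg
  have hgj : ∀ j : Fin n, g j = v (finProdFinEquiv (b, j)) - m := fun j => by
    simp only [hg, dif_pos j.isLt, Fin.eta]
  have hn0 : (n : ℝ) ≠ 0 := by exact_mod_cast (show n ≠ 0 by omega)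
  have hsum0 : ∑ l ∈ Finset.range n, g l = 0 := by
    rw [Finset.sum_range, Finset.sum_congr rfl fun j _ => hgj j, Finset.sum_sub_distrib, Finset.sum_const,
      Finset.card_univ, Fintype.card_fin, nsmul_eq_mul, hm]
    field_simp
    ring
  have hLb : ∑ j : Fin n, (v (finProdFinEquiv (b, j)) - m) ^ 2 = ∑ l ∈ Finset.range n, g l ^ 2 := by
    rw [Finset.sum_range]
    exact Finset.sum_congr rfl fun j _ => by rw [hgj]
  have hP := poincare_range n g hsum0
  set t : ℕ → ℝ := fun l => if h : l < n then
      ((n : ℝ) * (v (finProdFinEquiv (b, (⟨l, h⟩ : Fin n)) + 1) - v (finProdFinEquiv (b, (⟨l, h⟩ : Fin n))))) ^ 2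
    else 0 with ht
  have htj : ∀ j : Fin n,
      t j = ((n : ℝ) * (v (finProdFinEquiv (b, j) + 1) - v (finProdFinEquiv (b, j)))) ^ 2 :=
    fun j => by simp only [ht, dif_pos j.isLt, Fin.eta]
  have hRb : (n : ℝ) ^ 2 * ∑ l ∈ Finset.range (n - 1), (g (l + 1) - g l) ^ 2 ≤
      ∑ j : Fin n, ((n : ℝ) * (v (finProdFinEquiv (b, j) + 1) - v (finProdFinEquiv (b, j)))) ^ 2 := by
    have h1 : ∑ j : Fin n, ((n : ℝ) * (v (finProdFinEquiv (b, j) + 1) - v (finProdFinEquiv (b, j)))) ^ 2 =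
        ∑ l ∈ Finset.range n, t l := by
      rw [Finset.sum_range]; exact Finset.sum_congr rfl fun j _ => (htj j).symm
    have h2 : ∀ l ∈ Finset.range (n - 1), (n : ℝ) ^ 2 * (g (l + 1) - g l) ^ 2 = t l := by
      intro l hl
      have hl' : l + 1 < n := by simp only [Finset.mem_range] at hl; omega
      have hl'' : l < n := (Nat.lt_succ_self l).trans hl'
      simp only [ht, hg, dif_pos hl', dif_pos hl'']
      rw [finProdFinEquiv_succ hKn h1n b l hl']; ring
    rw [h1, Finset.mul_sum]
    calc ∑ l ∈ Finset.range (n - 1), (n : ℝ) ^ 2 * (g (l + 1) - g l) ^ 2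
        = ∑ l ∈ Finset.range (n - 1), t l := Finset.sum_congr rfl h2
      _ ≤ ∑ l ∈ Finset.range n, t l := Finset.sum_le_sum_of_subset_of_nonneg
          (Finset.range_mono (Nat.sub_le n 1))
          (fun l _ _ => by simp only [ht]; split_ifs <;> positivity)
  calc ∑ j : Fin n, (v (finProdFinEquiv (b, j)) - m) ^ 2 = ∑ l ∈ Finset.range n, g l ^ 2 := hLb
    _ ≤ (n : ℝ) ^ 2 * ∑ l ∈ Finset.range (n - 1), (g (l + 1) - g l) ^ 2 := hP
    _ ≤ _ := hRb

/-- THE 1D PARABOLA GEOMETRY IS ADMISSIBLE: `Z/(Kn)` with `K` blocks of `n ≥ 3` sites, direction `e = 1`, mesh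
rescaling `c = n`, profiles `theta n` (in-block parabolas): `N = n`, `a = 3/n` (so `N·a = 3`), mesh gradient
`12/n = 4a`, `C_P = 1` — all from the `T4ConstrainedAgmon` lemmas `card_fiber_divNat`, `theta_profileExact`,
`theta_support`, `abs_theta_le`, `abs_diff_theta_le`, `modNat_eq_last_of_exit` + `hprof_last` (exit faces) and
`devSq_block_1D`. [folklore] -/
theorem admissible_1D (hn : 3 ≤ n) :
    Admissible (n : ℝ) (fun _ : Fin 1 => (1 : Fin (K * n))) (Fin.divNat : Fin (K * n) → Fin K) (theta n)
      n (3 / n) 1 := by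
  have h1n : 1 < n := by omega
  have hKn : 1 < K * n := lt_of_lt_of_le h1n (Nat.le_mul_of_pos_left n (NeZero.pos K))
  exact
  { N_pos := by omega
    card_fiber := card_fiber_divNat
    profileExact := theta_profileExact hn
    support := fun b x hx => theta_support hKn h1n b x hx
    exit := fun b x _ hx hx1 => by
      rw [mem_fiber] at hx hx1
      have hne : (x + 1).divNat ≠ x.divNat := by rw [hx]; exact hx1
      have hlast := modNat_eq_last_of_exit hKn x hne
      rw [theta_apply, if_pos hx, hlast, hprof_last h1n.le, zero_div]
    profile_abs_le := abs_theta_le hn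
    profile_diff_le := fun b _ x => by
      rw [show (4:ℝ) * (3 / n) = 12 / n by ring]; exact abs_diff_theta_le hn b x
    CP_nonneg := zero_le_one
    poincare := fun b v => devSq_block_1D h1n b v }

end OneD

/-! ## §4 PRODUCTS of admissible geometries are admissible with the SAME Poincaré constant
(`N = N₁N₂`, `a = a₁a₂`): directions `ι₁ ⊕ ι₂`, blocks `Bk₁ × Bk₂`, product profiles `θ_{(b₁,b₂)} = θ¹_{b₁} ⊗ θ²_{b₂}`. -/

section Prod

variable {G₁ G₂ : Type*} [AddCommGroup G₁] [AddCommGroup G₂] [Fintype G₁] [Fintype G₂]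
  [DecidableEq G₁] [DecidableEq G₂] {ι₁ ι₂ : Type*} [Fintype ι₁] [Fintype ι₂]
  {Bk₁ Bk₂ : Type*} [Fintype Bk₁] [Fintype Bk₂] [DecidableEq Bk₁] [DecidableEq Bk₂]

/-- Product directions: `e(inl i) = (e₁ i, 0)`, `e(inr j) = (0, e₂ j)`. [folklore] -/
def prodDir (e₁ : ι₁ → G₁) (e₂ : ι₂ → G₂) : ι₁ ⊕ ι₂ → G₁ × G₂ :=
  Sum.elim (fun i => (e₁ i, 0)) (fun j => (0, e₂ j))

/-- Product block map: `blk(x₁,x₂) = (blk₁ x₁, blk₂ x₂)` (cubic blocks). [folklore] -/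
def prodBlk (blk₁ : G₁ → Bk₁) (blk₂ : G₂ → Bk₂) : G₁ × G₂ → Bk₁ × Bk₂ := fun x => (blk₁ x.1, blk₂ x.2)

/-- Product (tensor) profile family: `θ_{(b₁,b₂)}(x₁,x₂) = θ¹_{b₁}(x₁)·θ²_{b₂}(x₂)`. [folklore] -/
def prodProfile (θ₁ : Bk₁ → EuclideanSpace ℝ G₁) (θ₂ : Bk₂ → EuclideanSpace ℝ G₂) :
    Bk₁ × Bk₂ → EuclideanSpace ℝ (G₁ × G₂) :=
  fun b => WithLp.toLp 2 (fun x => θ₁ b.1 x.1 * θ₂ b.2 x.2)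

omit [AddCommGroup G₁] [AddCommGroup G₂] [Fintype G₁] [Fintype G₂] [DecidableEq G₁] [DecidableEq G₂]
  [Fintype Bk₁] [Fintype Bk₂] [DecidableEq Bk₁] [DecidableEq Bk₂] in
/-- Evaluation of the product profile. [folklore] -/
@[simp] theorem prodProfile_apply (θ₁ : Bk₁ → EuclideanSpace ℝ G₁) (θ₂ : Bk₂ → EuclideanSpace ℝ G₂)
    (b : Bk₁ × Bk₂) (x : G₁ × G₂) : prodProfile θ₁ θ₂ b x = θ₁ b.1 x.1 * θ₂ b.2 x.2 := rfl

omit [Fintype G₁] [Fintype G₂] [DecidableEq G₁] [DecidableEq G₂] [Fintype ι₁] [Fintype ι₂] in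
/-- Components of a shift in a `G₁`-direction. [folklore] -/
@[simp] theorem add_prodDir_inl (e₁ : ι₁ → G₁) (e₂ : ι₂ → G₂) (x : G₁ × G₂) (i : ι₁) :
    x + prodDir e₁ e₂ (Sum.inl i) = (x.1 + e₁ i, x.2) := by
  ext <;> simp [prodDir]

omit [Fintype G₁] [Fintype G₂] [DecidableEq G₁] [DecidableEq G₂] [Fintype ι₁] [Fintype ι₂] in
/-- Components of a shift in a `G₂`-direction. [folklore] -/
@[simp] theorem add_prodDir_inr (e₁ : ι₁ → G₁) (e₂ : ι₂ → G₂) (x : G₁ × G₂) (j : ι₂) :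
    x + prodDir e₁ e₂ (Sum.inr j) = (x.1, x.2 + e₂ j) := by
  ext <;> simp [prodDir]

omit [AddCommGroup G₁] [AddCommGroup G₂] [DecidableEq G₁] [DecidableEq G₂] [Fintype Bk₁] [Fintype Bk₂] in
/-- The blocks of a product geometry are the products of the blocks. [folklore] -/
theorem fiber_prodBlk (blk₁ : G₁ → Bk₁) (blk₂ : G₂ → Bk₂) (b : Bk₁ × Bk₂) :
    fiber (prodBlk blk₁ blk₂) b = fiber blk₁ b.1 ×ˢ fiber blk₂ b.2 := by
  ext x
  simp [mem_fiber, prodBlk, Finset.mem_product, Prod.ext_iff]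

omit [DecidableEq G₁] [DecidableEq G₂] [Fintype Bk₁] [Fintype Bk₂] in
/-- PRODUCT BLOCK POINCARÉ: if the deviation-form block Poincaré inequality holds for the two factors with constant
`C_P`, it holds for the product geometry with the SAME constant (`devSq_product_le` — variance tensorisation — then
the factors' inequalities line by line). [folklore] -/
theorem devSq_prod_le {c CP : ℝ} {e₁ : ι₁ → G₁} {e₂ : ι₂ → G₂} {blk₁ : G₁ → Bk₁} {blk₂ : G₂ → Bk₂}
    (hP₁ : ∀ b (v : G₁ → ℝ), devSq (fiber blk₁ b) v ≤
      CP * ∑ i, ∑ x ∈ fiber blk₁ b, (c * (v (x + e₁ i) - v x)) ^ 2)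
    (hP₂ : ∀ b (v : G₂ → ℝ), devSq (fiber blk₂ b) v ≤
      CP * ∑ i, ∑ x ∈ fiber blk₂ b, (c * (v (x + e₂ i) - v x)) ^ 2)
    (b : Bk₁ × Bk₂) (v : G₁ × G₂ → ℝ) :
    devSq (fiber (prodBlk blk₁ blk₂) b) v ≤
      CP * ∑ i, ∑ x ∈ fiber (prodBlk blk₁ blk₂) b, (c * (v (x + prodDir e₁ e₂ i) - v x)) ^ 2 := by
  rw [fiber_prodBlk]
  set F₁ := fiber blk₁ b.1 with hF₁
  set F₂ := fiber blk₂ b.2 with hF₂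
  have hA : ∑ x₂ ∈ F₂, devSq F₁ (fun x₁ => v (x₁, x₂)) ≤
      ∑ x₂ ∈ F₂, CP * ∑ i, ∑ x₁ ∈ F₁, (c * (v (x₁ + e₁ i, x₂) - v (x₁, x₂))) ^ 2 :=
    Finset.sum_le_sum fun x₂ _ => hP₁ b.1 (fun x₁ => v (x₁, x₂))
  have hB : ∑ x₁ ∈ F₁, devSq F₂ (fun x₂ => v (x₁, x₂)) ≤
      ∑ x₁ ∈ F₁, CP * ∑ j, ∑ x₂ ∈ F₂, (c * (v (x₁, x₂ + e₂ j) - v (x₁, x₂))) ^ 2 :=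
    Finset.sum_le_sum fun x₁ _ => hP₂ b.2 (fun x₂ => v (x₁, x₂))
  have hA' : ∑ x₂ ∈ F₂, CP * ∑ i, ∑ x₁ ∈ F₁, (c * (v (x₁ + e₁ i, x₂) - v (x₁, x₂))) ^ 2 =
      CP * ∑ i, ∑ x ∈ F₁ ×ˢ F₂, (c * (v (x + prodDir e₁ e₂ (Sum.inl i)) - v x)) ^ 2 := by
    rw [← Finset.mul_sum, Finset.sum_comm]
    congr 1
    refine Finset.sum_congr rfl fun i _ => ?_
    rw [Finset.sum_product, Finset.sum_comm]
    simp only [add_prodDir_inl]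
  have hB' : ∑ x₁ ∈ F₁, CP * ∑ j, ∑ x₂ ∈ F₂, (c * (v (x₁, x₂ + e₂ j) - v (x₁, x₂))) ^ 2 =
      CP * ∑ j, ∑ x ∈ F₁ ×ˢ F₂, (c * (v (x + prodDir e₁ e₂ (Sum.inr j)) - v x)) ^ 2 := by
    rw [← Finset.mul_sum, Finset.sum_comm]
    congr 1
    refine Finset.sum_congr rfl fun j _ => ?_
    rw [Finset.sum_product]
    simp only [add_prodDir_inr]
  calc devSq (F₁ ×ˢ F₂) v
      ≤ ∑ x₂ ∈ F₂, devSq F₁ (fun x₁ => v (x₁, x₂)) + ∑ x₁ ∈ F₁, devSq F₂ (fun x₂ => v (x₁, x₂)) :=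
        devSq_product_le F₁ F₂ v
    _ ≤ _ := add_le_add hA hB
    _ = CP * ∑ i, ∑ x ∈ F₁ ×ˢ F₂, (c * (v (x + prodDir e₁ e₂ i) - v x)) ^ 2 := by
        rw [hA', hB', Fintype.sum_sum_type, mul_add]

omit [DecidableEq G₁] [DecidableEq G₂] [Fintype Bk₁] [Fintype Bk₂] in
/-- PRODUCTS OF ADMISSIBLE GEOMETRIES ARE ADMISSIBLE, with `N = N₁N₂`, `a = a₁a₂` and the SAME `C_P`: fibres are
products (`fiber_prodBlk`), block sums of tensor profiles factor (exactness), support / exit faces / sup / mesh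
gradient (`4a₁·a₂ = a₁·4a₂ = 4a`) coordinate by coordinate, and the Poincaré constant by `devSq_prod_le`.  This
is the induction step from the 1D parabola geometry to the cubic block geometry of `(Z/(Kn))^d`. [folklore] -/
theorem Admissible.prod {c CP a₁ a₂ : ℝ} {N₁ N₂ : ℕ} {e₁ : ι₁ → G₁} {e₂ : ι₂ → G₂} {blk₁ : G₁ → Bk₁}
    {blk₂ : G₂ → Bk₂} {θ₁ : Bk₁ → EuclideanSpace ℝ G₁} {θ₂ : Bk₂ → EuclideanSpace ℝ G₂}
    (h₁ : Admissible c e₁ blk₁ θ₁ N₁ a₁ CP) (h₂ : Admissible c e₂ blk₂ θ₂ N₂ a₂ CP) :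
    Admissible c (prodDir e₁ e₂) (prodBlk blk₁ blk₂) (prodProfile θ₁ θ₂) (N₁ * N₂) (a₁ * a₂) CP where
  N_pos := Nat.mul_pos h₁.N_pos h₂.N_pos
  card_fiber := fun b => by rw [fiber_prodBlk, Finset.card_product, h₁.card_fiber, h₂.card_fiber]
  profileExact := by
    intro b b'
    rw [blockSum_apply, fiber_prodBlk, Finset.sum_product]
    simp only [prodProfile_apply]
    rw [← Finset.sum_mul_sum, ← blockSum_apply, ← blockSum_apply, h₁.profileExact b.1 b'.1,
      h₂.profileExact b.2 b'.2]
    by_cases hb : b = b'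
    · subst hb; simp
    · rw [if_neg hb]
      by_cases h : b.1 = b'.1
      · have h2 : b.2 ≠ b'.2 := fun h2 => hb (Prod.ext h h2)
        rw [if_neg h2, mul_zero]
      · rw [if_neg h, zero_mul]
  support := by
    intro b x hx
    rw [fiber_prodBlk, Finset.mem_product, not_and_or] at hx
    rcases hx with hx | hx
    · have hs := h₁.support b.1 x.1 hx
      refine ⟨by rw [prodProfile_apply, hs.1, zero_mul], fun i => ?_⟩
      cases i with
      | inl i => rw [add_prodDir_inl, prodProfile_apply, hs.2 i, zero_mul]
      | inr j => rw [add_prodDir_inr, prodProfile_apply, hs.1, zero_mul]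
    · have hs := h₂.support b.2 x.2 hx
      refine ⟨by rw [prodProfile_apply, hs.1, mul_zero], fun i => ?_⟩
      cases i with
      | inl i => rw [add_prodDir_inl, prodProfile_apply, hs.1, mul_zero]
      | inr j => rw [add_prodDir_inr, prodProfile_apply, hs.2 j, mul_zero]
  exit := by
    intro b x i hx hx1
    rw [fiber_prodBlk, Finset.mem_product] at hx hx1
    cases i with
    | inl i =>
      rw [add_prodDir_inl] at hx1
      have h1 : x.1 + e₁ i ∉ fiber blk₁ b.1 := fun h => hx1 ⟨h, hx.2⟩
      rw [prodProfile_apply, h₁.exit b.1 x.1 i hx.1 h1, zero_mul]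
    | inr j =>
      rw [add_prodDir_inr] at hx1
      have h2 : x.2 + e₂ j ∉ fiber blk₂ b.2 := fun h => hx1 ⟨hx.1, h⟩
      rw [prodProfile_apply, h₂.exit b.2 x.2 j hx.2 h2, mul_zero]
  profile_abs_le := fun b x => by
    rw [prodProfile_apply, abs_mul]
    exact mul_le_mul (h₁.profile_abs_le _ _) (h₂.profile_abs_le _ _) (abs_nonneg _) h₁.a_nonneg
  profile_diff_le := by
    intro b i x
    have ha₁ := h₁.a_nonneg
    have ha₂ := h₂.a_nonneg
    cases i with
    | inl i =>
      rw [add_prodDir_inl, prodProfile_apply, prodProfile_apply]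
      have : c * (θ₁ b.1 (x.1 + e₁ i) * θ₂ b.2 x.2 - θ₁ b.1 x.1 * θ₂ b.2 x.2) =
          (c * (θ₁ b.1 (x.1 + e₁ i) - θ₁ b.1 x.1)) * θ₂ b.2 x.2 := by ring
      rw [this, abs_mul]
      calc |c * (θ₁ b.1 (x.1 + e₁ i) - θ₁ b.1 x.1)| * |θ₂ b.2 x.2| ≤ 4 * a₁ * a₂ :=
            mul_le_mul (h₁.profile_diff_le _ _ _) (h₂.profile_abs_le _ _) (abs_nonneg _) (by positivity)
        _ = 4 * (a₁ * a₂) := by ring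
    | inr j =>
      rw [add_prodDir_inr, prodProfile_apply, prodProfile_apply]
      have : c * (θ₁ b.1 x.1 * θ₂ b.2 (x.2 + e₂ j) - θ₁ b.1 x.1 * θ₂ b.2 x.2) =
          θ₁ b.1 x.1 * (c * (θ₂ b.2 (x.2 + e₂ j) - θ₂ b.2 x.2)) := by ring
      rw [this, abs_mul]
      calc |θ₁ b.1 x.1| * |c * (θ₂ b.2 (x.2 + e₂ j) - θ₂ b.2 x.2)| ≤ a₁ * (4 * a₂) :=
            mul_le_mul (h₁.profile_abs_le _ _) (h₂.profile_diff_le _ _ _) (abs_nonneg _) ha₁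
        _ = 4 * (a₁ * a₂) := by ring
  CP_nonneg := h₁.CP_nonneg
  poincare := devSq_prod_le h₁.poincare h₂.poincare

end Prod

/-! ## §5 THE FOUR-DIMENSIONAL CUBIC BLOCK GEOMETRY `(Z/(Kn))^4` (the T⁴ block model): admissible with
`N·a = 81`, `C_P = 1`; the assembled constrained Agmon bound with tangent-only coercivity and tangent-only source,
EVERY CONSTANT INDEPENDENT OF THE MESH `n` AND THE VOLUME `K`. -/

section FourD

variable {K n : ℕ} [NeZero K] [NeZero n]

/-- The sites of the four-dimensional discrete torus `(Z/(Kn))^4`, as an iterated product (dictionary: the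
`η`-lattice `T_η`, `η = 1/n = L^{-k}`, torus side `K` unit blocks). [folklore] -/
abbrev Torus4 (K n : ℕ) : Type := Fin (K * n) × (Fin (K * n) × (Fin (K * n) × Fin (K * n)))

/-- The four lattice directions. [folklore] -/
abbrev Dir4 : Type := Fin 1 ⊕ (Fin 1 ⊕ (Fin 1 ⊕ Fin 1))

/-- The unit blocks of `(Z/(Kn))^4`: `K^4` cubes of `n^4` sites. [folklore] -/
abbrev Blocks4 (K : ℕ) : Type := Fin K × (Fin K × (Fin K × Fin K))

/-- The unit lattice vectors of `(Z/(Kn))^4`. [folklore] -/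
def dir4 : Dir4 → Torus4 K n :=
  prodDir (fun _ : Fin 1 => (1 : Fin (K * n)))
    (prodDir (fun _ : Fin 1 => (1 : Fin (K * n)))
      (prodDir (fun _ : Fin 1 => (1 : Fin (K * n))) (fun _ : Fin 1 => (1 : Fin (K * n)))))

/-- The cubic block map of `(Z/(Kn))^4` (coordinatewise `Fin.divNat`). [folklore] -/
def blk4 : Torus4 K n → Blocks4 K :=
  prodBlk Fin.divNat (prodBlk Fin.divNat (prodBlk Fin.divNat Fin.divNat))

/-- The tensor parabola profiles of `(Z/(Kn))^4`: `θ_b(x) = Π_μ h(pos x_μ)/n` on the cube `b`, zero on all its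
faces. [folklore] -/
def theta4 (n : ℕ) : Blocks4 K → EuclideanSpace ℝ (Torus4 K n) :=
  prodProfile (theta n) (prodProfile (theta n) (prodProfile (theta n) (theta n)))

/-- There are four directions. [folklore] -/
theorem card_Dir4 : Fintype.card Dir4 = 4 := by
  simp [Fintype.card_sum]

/-- THE T⁴ BLOCK GEOMETRY IS ADMISSIBLE: `(Z/(Kn))^4` with cubic blocks of `n^4` sites (`n ≥ 3`), unit directions,
mesh rescaling `c = n`, tensor parabola profiles: `N = n^4`, `a = (3/n)^4` (`N·a = 81`), `C_P = 1` — three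
applications of `Admissible.prod` to `admissible_1D`.  In particular the BLOCK POINCARÉ INEQUALITY
`‖v‖² ≤ Σ_μ ‖n∇_μ v‖²` holds on the block tangent space of the four-dimensional torus with constant ONE, uniformly
in `n` and `K` (`Admissible.poincare_tangent`). [folklore] -/
theorem admissible_4D (hn : 3 ≤ n) :
    Admissible (n : ℝ) (dir4 : Dir4 → Torus4 K n) blk4 (theta4 n) (n ^ 4) ((3 / n) ^ 4) 1 := by
  have h := admissible_1D (K := K) hn
  have h4 := h.prod (h.prod (h.prod h))
  have hN : n * (n * (n * n)) = n ^ 4 := by ring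
  have ha : (3 / (n : ℝ)) * (3 / n * (3 / n * (3 / n))) = (3 / n) ^ 4 := by ring
  rw [hN, ha] at h4
  exact h4

/-- Block Poincaré on the tangent space of the T⁴ block model, constant one, uniform in mesh and volume.
[folklore] -/
theorem block_poincare_4D (hn : 3 ≤ n) (v : EuclideanSpace ℝ (Torus4 K n)) (hv : v ∈ blockTangent blk4) :
    ‖v‖ ^ 2 ≤ ∑ i, ‖fwdDiff (n : ℝ) dir4 i v‖ ^ 2 := by
  have := (admissible_4D (K := K) hn).poincare_tangent v hv
  rwa [one_mul] at this

/-- TANGENT-ONLY COERCIVITY OF THE MASSLESS / SUB-MASS FORM ON T⁴: for all `0 ≤ s₀`, `0 ≤ s`,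
`(1/(1+s))·N_s(v)² ≤ B_{s₀}(v,v)` for every `v` in the block tangent space of `(Z/(Kn))^4` — the model analogue of
the cell-SUPPLIED lemma ML (tangent-only strong second variation), with modulus `1/(1+s)` independent of `n` and `K`;
for `s₀ = 0` the form is the massless difference form, NOT coercive on constants. [folklore] -/
theorem coercive_blockTangent_4D (hn : 3 ≤ n) {s₀ s : ℝ} (hs₀ : 0 ≤ s₀) (hs : 0 ≤ s) :
    ∀ v ∈ blockTangent (blk4 : Torus4 K n → Blocks4 K),
      1 / (1 + s) * energyNorm (n : ℝ) dir4 s v ^ 2 ≤ latticeForm (n : ℝ) dir4 s₀ v v := by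
  have := (admissible_4D (K := K) hn).coercive hs₀ hs
  rwa [mul_one] at this

/-- THE FOUR-DIMENSIONAL MODEL THEOREM ((δ1′)+(δ2′) in the T⁴ block geometry): on `(Z/(Kn))^4` with cubic blocks
of `n^4` sites (`n ≥ 3`; dictionary `n = L^k = η⁻¹`, `K` = torus side in unit blocks), mesh derivative `c = n`,
form `B = latticeForm n dir4 s₀` with `0 ≤ s₀ ≤ s` — `s₀ = 0` the MASSLESS fluctuation form —, gauge
`N = energyNorm n dir4 s`, a weight `ω > 0` with `n|ω(x+e_μ) − ω(x)| ≤ μ ω` at both ends of every bond and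
`|ω² − ω̄_b²| ≤ ϑω̄_b²` on cube `b`, a weak solution `u ∈ T_Q` of `B(u,v) = J v` (`v ∈ T_Q`) whose source is bounded
ONLY on tangent test fields, `|Jφ| ≤ ρN(ω⁻¹φ)` (`φ ∈ T_Q`).  Then for `θ₁ ∈ [0,1]`, `θ₂ ≥ 0` with
`θ₁² ≥ ϑ²·6561(64 + s)/((1−ϑ)s)`, `θ₂² ≥ ϑ²·6561(4(4+μ)² + s)/((1−ϑ)²s)` and
`4μ²/s + (1 + μ√(4/s))²θ₂ + θ₁(2+θ₁) < (1−θ₁)²/(1+s)`: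
`N(ωu) ≤ ρ(1 + √((1+ϑ)·6561(4(4+μ)²+s)/((1−ϑ)s)))(1+θ₂) / ((1−θ₁)²/(1+s) − θ₁(2+θ₁) − 4μ²/s − (1+μ√(4/s))²θ₂)`
— EVERY CONSTANT INDEPENDENT OF `n` AND `K` (`6561 = 81² = (N·a)²`).  `Admissible.agmon_tangentSource` for
`admissible_4D`.  HONEST SCOPE: scalar fields, plain block sums (the covariant average Q_k(U) of (19) and the
gauge half `R D* W = 0` of the tangent space are NOT modelled — items (δ3)–(δ5) of the record); coercivity on
`T_Q` is the model's own (block Poincaré), in the dictionary it is the cell-SUPPLIED lemma ML, a hypothesis.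
[folklore] [cite: Balaban1985Variational, (79)–(84) p. 290, (115) p. 294, (116)–(117) p. 295 (context);
(19)–(21) p. 281 (context: the constraints)] -/
theorem constrained_lattice_agmon_4D_tangentSource (hn : 3 ≤ n) {s₀ s μ ϑ θ₁ θ₂ ρ : ℝ} (hs : 0 < s)
    (hs₀ : 0 ≤ s₀) (hs₀s : s₀ ≤ s) (hμ : 0 ≤ μ)
    (ω : Torus4 K n → ℝ) (hpos : ∀ x, 0 < ω x)
    (hω : ∀ i x, (n : ℝ) ^ 2 * (ω (x + dir4 i) - ω x) ^ 2 ≤ μ ^ 2 * ω x ^ 2 ∧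
      (n : ℝ) ^ 2 * (ω (x + dir4 i) - ω x) ^ 2 ≤ μ ^ 2 * ω (x + dir4 i) ^ 2)
    (ωbar : Blocks4 K → ℝ) (hωbar : ∀ b, 0 < ωbar b) (hϑ : 0 ≤ ϑ) (hϑ1 : ϑ < 1)
    (hW1 : ∀ x, |ω x ^ 2 - ωbar (blk4 x) ^ 2| ≤ ϑ * ωbar (blk4 x) ^ 2)
    (hθ₁0 : 0 ≤ θ₁) (hθ₁1 : θ₁ ≤ 1) (hθ₂0 : 0 ≤ θ₂)
    (hθ₁ : ϑ ^ 2 / (1 - ϑ) * (6561 * (64 + s)) / s ≤ θ₁ ^ 2)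
    (hθ₂ : ϑ ^ 2 / (1 - ϑ) ^ 2 * (6561 * (4 * (4 + μ) ^ 2 + s)) / s ≤ θ₂ ^ 2)
    (hden : 4 * μ ^ 2 / s + (1 + μ * Real.sqrt (4 / s)) ^ 2 * θ₂ + θ₁ * (2 + θ₁) <
      1 / (1 + s) * (1 - θ₁) ^ 2)
    {u : EuclideanSpace ℝ (Torus4 K n)} (hu : u ∈ blockTangent blk4)
    (J : EuclideanSpace ℝ (Torus4 K n) →ₗ[ℝ] ℝ) (hρ : 0 ≤ ρ)
    (hweak : ∀ v ∈ blockTangent blk4, latticeForm (n : ℝ) dir4 s₀ u v = J v)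
    (hJT : ∀ φ ∈ blockTangent blk4, |J φ| ≤
      ρ * energyNorm (n : ℝ) dir4 s (mulOp (fun x => (ω x)⁻¹) φ)) :
    energyNorm (n : ℝ) dir4 s (mulOp ω u) ≤
      (ρ * (1 + Real.sqrt ((1 + ϑ) * (6561 * (4 * (4 + μ) ^ 2 + s) / (1 - ϑ)) / s)) * (1 + θ₂)) /
      (1 / (1 + s) * (1 - θ₁) ^ 2 - θ₁ * (2 + θ₁) - 4 * μ ^ 2 / s
        - (1 + μ * Real.sqrt (4 / s)) ^ 2 * θ₂) := by
  have hA := admissible_4D (K := K) hn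
  have hn0 : (n : ℝ) ≠ 0 := by exact_mod_cast (show n ≠ 0 by omega)
  have hNa : (((n ^ 4 : ℕ) : ℝ) * (3 / (n : ℝ)) ^ 4) ^ 2 = 6561 := by
    push_cast; field_simp; norm_num
  have hc4 : (Fintype.card Dir4 : ℝ) = 4 := by rw [card_Dir4]; norm_num
  have key := hA.agmon_tangentSource hs hs₀ hs₀s hμ ω hpos hω ωbar hωbar hϑ hϑ1 hW1 hθ₁0 hθ₁1 hθ₂0
    (by rw [hNa, hc4]; convert hθ₁ using 3; ring)
    (by rw [hNa, hc4]; exact hθ₂)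
    (by rw [hc4, mul_one]; exact hden) hu J hρ hweak hJT
  rw [hNa, hc4, mul_one] at key
  exact key

/-! ### Non-vacuity of the smallness conditions (the constrained Agmon bounds are not vacuous) -/

/-- NON-VACUITY, ONE DIMENSION (answer to the outside reading C-pv25g11-3, remark R2): the data
`(s, μ, ϑ, θ₁, θ₂) = (1, 1/10, 10⁻³, 0.013, 0.013)` satisfy the three smallness hypotheses `hθ₁`, `hθ₂`, `hden` of
`constrained_lattice_agmon_1D_of_le` / `constrained_lattice_agmon_1D_tangentSource`. [folklore] -/
example :
    ((1:ℝ) / 1000) ^ 2 / (1 - 1 / 1000) * (144 + 9 * 1) / 1 ≤ (13 / 1000) ^ 2 ∧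
    ((1:ℝ) / 1000) ^ 2 / (1 - 1 / 1000) ^ 2 * ((12 + 3 * (1 / 10)) ^ 2 + 9 * 1) / 1 ≤ (13 / 1000) ^ 2 ∧
    ((1:ℝ) / 10) ^ 2 / 1 + (1 + 1 / 10 * Real.sqrt (1 / 1)) ^ 2 * (13 / 1000)
      + 13 / 1000 * (2 + 13 / 1000) < 1 / (1 + 1) * (1 - 13 / 1000) ^ 2 := by
  refine ⟨by norm_num, by norm_num, ?_⟩
  rw [div_self one_ne_zero, Real.sqrt_one]
  norm_num

/-- NON-VACUITY, FOUR DIMENSIONS: the data `(s, μ, ϑ, θ₁, θ₂) = (1, 1/10, 1/20000, 1/20, 1/20)` satisfy the three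
smallness hypotheses of `constrained_lattice_agmon_4D_tangentSource`. [folklore] -/
example :
    ((1:ℝ) / 20000) ^ 2 / (1 - 1 / 20000) * (6561 * (64 + 1)) / 1 ≤ (1 / 20) ^ 2 ∧
    ((1:ℝ) / 20000) ^ 2 / (1 - 1 / 20000) ^ 2 * (6561 * (4 * (4 + 1 / 10) ^ 2 + 1)) / 1 ≤ (1 / 20) ^ 2 ∧
    4 * ((1:ℝ) / 10) ^ 2 / 1 + (1 + 1 / 10 * Real.sqrt (4 / 1)) ^ 2 * (1 / 20)
      + 1 / 20 * (2 + 1 / 20) < 1 / (1 + 1) * (1 - 1 / 20) ^ 2 := by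
  refine ⟨by norm_num, by norm_num, ?_⟩
  have : Real.sqrt (4 / 1) = 2 := by
    rw [div_one, show (4:ℝ) = 2 ^ 2 by norm_num, Real.sqrt_sq (by norm_num)]
  rw [this]
  norm_num

end FourD

/-! ## §6 (v1.1) Non-finite-range tangent corrections: a general projector onto the tangent space,
the Schur test in the energy gauge, and exponentially localised kernels ((δ5) at model level)

The discharges of §2–§5 correct the conjugated field `ωu` back into the block tangent space `T_Q` along the
FINITE-RANGE lift of the block sums (`blockCorr`, `tangentProj`).  In the dictionary the tangent space of the
constraints has a second, GAUGE half (`R D* A = 0` next to the averaging constraints, (45) p. 285), and a right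
inverse of `D*` is a Green's function: the correction cannot be finite-range.  This section removes finite range
from the mechanism.  (a) `agmon_constrained_tangent_projector`: over a bare vector space, ANY linear projector `P`
onto `T` (`P = id` on `T`, range in `T`) supplies both corrections of `agmon_constrained_tangent_dual`, with
`θ₁ = ‖wPw⁻¹ − P‖_{N→N}` and `θ₂ = θ₁ + ‖P − w⁻¹Pw‖_{N→N}` — the price of the projector is exactly its two
CONJUGATION DEFECTS in the gauge (for `u ∈ T`: `wu − (wPw⁻¹ − P)(wu) = P(wu) ∈ T`, and
`w⁻¹(w(wu) − P(w(wu))) = (wPw⁻¹ − P)(wu) + (P − w⁻¹Pw)(wu)`).  (b) `norm_kernelOp_sq_le` (Schur test on ℓ²(G):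
‖T_t v‖² ≤ R·C·‖v‖² from row sums ≤ R and column sums ≤ C) and `energyNorm_kernelOp_le` (the same in the energy
gauge `N_s`, through the x-gradient kernel: `fwdDiff_kernelOp`).  (c) `kernel_conjugationDefect_energy_le`: if the
kernel `p` of `P` and its x-gradient kernel have exponential moments `Σ_y |p(x,y)|e^{a d(x,y)} ≤ C_p`,
`Σ_y |c∇ₓp(x,y)|e^{a d(x+e_i,y)} ≤ C_p′` (rows and columns; `d ≥ 0` is any gauge of separation — no triangle
inequality is used), the weight is log-Lipschitz along `d` with rate `ν ≤ a` (`|log ω(x) − log ω(y)| ≤ ν d(x,y)`) and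
mesh-Lipschitz with rate `μ`, then `N_s((ωPω⁻¹ − P)h) ≤ Θ N_s(h)` with `Θ² = #ι(ν C_p′/a + μ C_p)²/s + (ν C_p/a)²`
— i.e. `θ₁ = O(ν + μ)`: the Agmon rate must be small against the LOCALISATION RATE `a` of the projector, and
nothing depends on the mesh or the volume (pointwise: `|ω(x)/ω(y) − 1| ≤ (ν/a)e^{a d(x,y)}` by the chord inequality
`e^{νt} − 1 ≤ (ν/a)(e^{at} − 1)`, `exp_mul_sub_one_le_chord`).  (d) `constrained_lattice_agmon_projector` (the
assembled lattice theorem for an ARBITRARY tangent subspace `T ≤ ℓ²(G)` and an arbitrary projector onto it, sub-mass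
form, tangent-only coercivity as the hypothesis `hcoerT`) and `constrained_lattice_agmon_localized` (the same with
(c) plugged in for `ω` and `ω⁻¹`: `θ₁ = Θ`, `θ₂ = 2Θ`), plus a non-vacuity `example`.
HONEST SCOPE.  Finite-dimensional linear algebra and calculus, all [folklore].  What it certifies: the mechanism
«Agmon conjugation + tangent correction» does not need finite-range corrections — an exponentially localised
projector onto the tangent space costs `O((ν + μ)·(C_p + C_p′))` with `ν, μ` the Agmon rates and `C_p, C_p′` the
exponential moments of its kernel at a rate `a ≥ ν`.  What it does NOT: it does not construct such a projector for
Bałaban's constraint space `{Q(…) = 0, R D* = 0}`; that the composition of the operator `H` of (45) p. 285 with the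
constraint maps has kernel and gradient-kernel moments of this type, uniformly in `k`, is an input of PRINTED TYPE
((46) p. 285 and the pseudo-locality bounds (63)–(73) pp. 287–289) whose bookkeeping is the dictionary item (δ5) of
the record — NOT done here; vector/Lie-algebra values, the covariant averages and ML are untouched ((δ3), (δ4)).
NOT summit progress. [cite: Balaban1985Variational, (44)–(47) p. 285, (63)–(73) pp. 287–289, (79)–(84) p. 290
(context: the operator H, the pseudo-locality of the kernels, the Hessian on the constraint surface)] -/

section ProjectorShape

variable {E : Type*} [AddCommGroup E] [Module ℝ E]

/-- TANGENT CORRECTIONS FROM AN ARBITRARY PROJECTOR.  In the setting of `agmon_constrained_tangent_dual` let `P` be a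
linear projector onto `T` (`P v = v` for `v ∈ T`, `P h ∈ T` for all `h`), `winv` a left inverse of the weight `w`, and
let the two conjugation defects of `P` be bounded in the gauge: `N((w P winv − P)h) ≤ θa N(h)`,
`N((P − winv P w)h) ≤ θb N(h)`.  For `u ∈ T` the corrections `c₁ := (w P winv − P)(wu)` (so `wu − c₁ = P(wu) ∈ T`)
and `c₂ := w(wu) − P(w(wu))` (so `winv c₂ = c₁ + (P − winv P w)(wu)`) satisfy the hypotheses of
`agmon_constrained_tangent_dual` with `θ₁ = θa`, `θ₂ = θa + θb`; hence
`N(wu) ≤ ρ(1 + θa + θb)/(m(1−θa)² − Λθa(2+θa) − κ − Λ_w(θa+θb))`.  No finite range anywhere. [folklore]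
[cite: Balaban1985Variational, (45) p. 285, (79)–(84) p. 290 (context: the two halves of the constraint surface and
the Hessian restricted to its tangent space)] -/
theorem agmon_constrained_tangent_projector (B : E →ₗ[ℝ] E →ₗ[ℝ] ℝ) (w winv P : E →ₗ[ℝ] E)
    (T : Submodule ℝ E) (N : E → ℝ) (J : E →ₗ[ℝ] ℝ) {m Λ Λw κ θa θb ρ : ℝ}
    (hm : κ + Λw * (θa + θb) + Λ * θa * (2 + θa) < m * (1 - θa) ^ 2) (hm₀ : 0 ≤ m) (hΛ : 0 ≤ Λ)
    (hΛw : 0 ≤ Λw) (hθa : 0 ≤ θa) (hθa' : θa ≤ 1) (hθb : 0 ≤ θb) (hρ : 0 ≤ ρ)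
    (hcoerT : ∀ v ∈ T, m * N v ^ 2 ≤ B v v) (hcont : ∀ v h, |B v h| ≤ Λ * N v * N h)
    (hNsub : ∀ a b, N a ≤ N (a - b) + N b) (hNnn : ∀ v, 0 ≤ N v)
    (hAg : ConjugationDefect B w N κ)
    (hwinv : ∀ v, winv (w v) = v) (hPT : ∀ v ∈ T, P v = v) (hPr : ∀ h, P h ∈ T)
    (hda : ∀ h, N ((w ∘ₗ P ∘ₗ winv - P) h) ≤ θa * N h)
    (hdb : ∀ h, N ((P - winv ∘ₗ P ∘ₗ w) h) ≤ θb * N h)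
    {u : E} (hu : u ∈ T)
    (hwcont : ∀ h, |B u h| ≤ Λw * N (w u) * N (winv h)) (hJ' : ∀ h, |J h| ≤ ρ * N (winv h))
    (hweak : ∀ v ∈ T, B u v = J v) :
    N (w u) ≤ (ρ + ρ * (θa + θb)) /
      (m * (1 - θa) ^ 2 - Λ * θa * (2 + θa) - κ - Λw * (θa + θb)) := by
  set c₁ := (w ∘ₗ P ∘ₗ winv - P) (w u) with hc₁def
  set c₂ := w (w u) - P (w (w u)) with hc₂def
  have hPu : P u = u := hPT u hu
  have hc₁eq : c₁ = w u - P (w u) := by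
    simp only [hc₁def, LinearMap.sub_apply, LinearMap.comp_apply, hwinv, hPu]
  have hc₁T : w u - c₁ ∈ T := by
    rw [hc₁eq, sub_sub_cancel]; exact hPr _
  have hc₂T : w (w u) - c₂ ∈ T := by
    rw [hc₂def, sub_sub_cancel]; exact hPr _
  have hc₁ : N c₁ ≤ θa * N (w u) := hda (w u)
  have hwc₂ : winv c₂ = c₁ + (P - winv ∘ₗ P ∘ₗ w) (w u) := by
    rw [hc₂def, hc₁eq, map_sub, hwinv]
    simp only [LinearMap.sub_apply, LinearMap.comp_apply]
    abel
  have hc₂ : N (winv c₂) ≤ (θa + θb) * N (w u) := by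
    rw [hwc₂]
    have h1 : N (c₁ + (P - winv ∘ₗ P ∘ₗ w) (w u)) ≤ N c₁ + N ((P - winv ∘ₗ P ∘ₗ w) (w u)) := by
      have := hNsub (c₁ + (P - winv ∘ₗ P ∘ₗ w) (w u)) ((P - winv ∘ₗ P ∘ₗ w) (w u))
      rwa [add_sub_cancel_right] at this
    have h2 := hdb (w u)
    linarith
  have hJ : WeightedDualBound J w N ρ := fun v => by
    have := hJ' (w v); rwa [hwinv] at this
  exact agmon_constrained_tangent_dual B w T N (fun h => N (winv h)) J hm hm₀ hΛ hΛw hθa hθa'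
    (by positivity) hρ hcoerT hcont hNsub hNnn hAg hwcont hJ' hc₁T hc₂T hc₁ hc₂ hweak hJ

end ProjectorShape

section KernelSchur

variable {G : Type*} [AddCommGroup G] [Fintype G] [DecidableEq G] {ι : Type*} [Fintype ι]

/-- Weighted Cauchy–Schwarz (Jensen for the measure |k|): (Σ k·v)² ≤ (Σ|k|)·(Σ|k|v²). [folklore] -/
theorem sq_sum_mul_le_schur {α : Type*} (s : Finset α) (k v : α → ℝ) :
    (∑ y ∈ s, k y * v y) ^ 2 ≤ (∑ y ∈ s, |k y|) * ∑ y ∈ s, |k y| * v y ^ 2 := by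
  have h1 : |∑ y ∈ s, k y * v y| ≤ ∑ y ∈ s, Real.sqrt |k y| * (Real.sqrt |k y| * |v y|) := by
    refine (Finset.abs_sum_le_sum_abs _ _).trans (le_of_eq (Finset.sum_congr rfl fun y _ => ?_))
    rw [← mul_assoc, Real.mul_self_sqrt (abs_nonneg _), abs_mul]
  have h2 := Finset.sum_mul_sq_le_sq_mul_sq s (fun y => Real.sqrt |k y|) (fun y => Real.sqrt |k y| * |v y|)
  have h3 : ∑ y ∈ s, Real.sqrt |k y| ^ 2 = ∑ y ∈ s, |k y| :=
    Finset.sum_congr rfl fun y _ => Real.sq_sqrt (abs_nonneg _)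
  have h4 : ∑ y ∈ s, (Real.sqrt |k y| * |v y|) ^ 2 = ∑ y ∈ s, |k y| * v y ^ 2 :=
    Finset.sum_congr rfl fun y _ => by rw [mul_pow, Real.sq_sqrt (abs_nonneg _), sq_abs]
  rw [h3, h4] at h2
  calc (∑ y ∈ s, k y * v y) ^ 2 = |∑ y ∈ s, k y * v y| ^ 2 := (sq_abs _).symm
    _ ≤ (∑ y ∈ s, Real.sqrt |k y| * (Real.sqrt |k y| * |v y|)) ^ 2 :=
        pow_le_pow_left₀ (abs_nonneg _) h1 2
    _ ≤ _ := h2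

omit [AddCommGroup G] [DecidableEq G] in
/-- SCHUR TEST for kernel operators on ℓ²(G): row sums of |t| ≤ R and column sums ≤ C give
‖T_t v‖² ≤ R·C·‖v‖². [folklore] -/
theorem norm_kernelOp_sq_le (t : G → G → ℝ) {R C : ℝ} (hR : 0 ≤ R) (hrow : ∀ x, ∑ y, |t x y| ≤ R)
    (hcol : ∀ y, ∑ x, |t x y| ≤ C) (v : EuclideanSpace ℝ G) :
    ‖kernelOp t v‖ ^ 2 ≤ R * C * ‖v‖ ^ 2 := by
  rw [norm_sq_eq_sum, norm_sq_eq_sum]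
  simp only [kernelOp_apply]
  calc ∑ x, (∑ y, t x y * v y) ^ 2 ≤ ∑ x, R * ∑ y, |t x y| * v y ^ 2 := by
        refine Finset.sum_le_sum fun x _ => (sq_sum_mul_le_schur _ _ _).trans ?_
        exact mul_le_mul_of_nonneg_right (hrow x) (Finset.sum_nonneg fun y _ => by positivity)
    _ = R * ∑ x, ∑ y, |t x y| * v y ^ 2 := by rw [Finset.mul_sum]
    _ = R * ∑ y, ∑ x, |t x y| * v y ^ 2 := by rw [Finset.sum_comm]
    _ ≤ R * ∑ y, C * v y ^ 2 := by
        refine mul_le_mul_of_nonneg_left (Finset.sum_le_sum fun y _ => ?_) hR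
        rw [← Finset.sum_mul]
        exact mul_le_mul_of_nonneg_right (hcol y) (sq_nonneg _)
    _ = R * C * ∑ y, v y ^ 2 := by rw [← Finset.mul_sum]; ring

omit [Fintype G] [DecidableEq G] [Fintype ι] in
/-- The x-gradient of a kernel operator is the kernel operator of the x-gradient kernel:
`c∇_i(T_t v) = T_{c∇_i t(·,y)} v`. [folklore] -/
theorem fwdDiff_kernelOp [Fintype G] (c : ℝ) (e : ι → G) (i : ι) (t : G → G → ℝ) (v : EuclideanSpace ℝ G) :
    fwdDiff c e i (kernelOp t v) = kernelOp (fun x y => c * (t (x + e i) y - t x y)) v := by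
  ext x
  simp only [fwdDiff_apply, kernelOp_apply]
  rw [← Finset.sum_sub_distrib, Finset.mul_sum]
  exact Finset.sum_congr rfl fun y _ => by ring

omit [DecidableEq G] in
/-- SCHUR TEST IN THE ENERGY GAUGE: with Schur data `(R, C)` for the kernel and `(R′, C′)` for its x-gradient kernels,
`N_s(T_t v) ≤ Θ N_s(v)` as soon as `#ι·R′C′/s + RC ≤ Θ²` (uses only the mass part `s‖v‖² ≤ N_s(v)²` of the gauge
of `v`). [folklore] -/
theorem energyNorm_kernelOp_le (c : ℝ) (e : ι → G) {s : ℝ} (hs : 0 < s) (t : G → G → ℝ) {R C R' C' Θ : ℝ}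
    (hR : 0 ≤ R) (hR' : 0 ≤ R') (hRC : 0 ≤ R * C) (hRC' : 0 ≤ R' * C')
    (hrow : ∀ x, ∑ y, |t x y| ≤ R) (hcol : ∀ y, ∑ x, |t x y| ≤ C)
    (hrow' : ∀ i x, ∑ y, |c * (t (x + e i) y - t x y)| ≤ R')
    (hcol' : ∀ i y, ∑ x, |c * (t (x + e i) y - t x y)| ≤ C')
    (hΘ0 : 0 ≤ Θ) (hΘ : Fintype.card ι * (R' * C') / s + R * C ≤ Θ ^ 2) (v : EuclideanSpace ℝ G) :
    energyNorm c e s (kernelOp t v) ≤ Θ * energyNorm c e s v := by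
  have hs0 := hs.le
  have hdec : ∀ w : EuclideanSpace ℝ G,
      energyNorm c e s w ^ 2 = ∑ i, ‖fwdDiff c e i w‖ ^ 2 + s * ‖w‖ ^ 2 := fun w => by
    rw [energyNorm_sq c e hs0, latticeForm_apply]; simp only [real_inner_self_eq_norm_sq]
  have hv2 : ‖v‖ ^ 2 ≤ energyNorm c e s v ^ 2 / s := by
    rw [le_div_iff₀ hs]; have := norm_sq_le_energyNorm_sq c e hs0 v; linarith
  have h1 : ∀ i, ‖fwdDiff c e i (kernelOp t v)‖ ^ 2 ≤ R' * C' * ‖v‖ ^ 2 := fun i => by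
    rw [fwdDiff_kernelOp]; exact norm_kernelOp_sq_le _ hR' (hrow' i) (hcol' i) v
  have h2 : ‖kernelOp t v‖ ^ 2 ≤ R * C * ‖v‖ ^ 2 := norm_kernelOp_sq_le t hR hrow hcol v
  have hs' : s ≠ 0 := hs.ne'
  have hsq : energyNorm c e s (kernelOp t v) ^ 2 ≤ (Θ * energyNorm c e s v) ^ 2 := by
    rw [hdec, mul_pow]
    calc ∑ i, ‖fwdDiff c e i (kernelOp t v)‖ ^ 2 + s * ‖kernelOp t v‖ ^ 2
        ≤ ∑ _i : ι, R' * C' * ‖v‖ ^ 2 + s * (R * C * ‖v‖ ^ 2) :=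
          add_le_add (Finset.sum_le_sum fun i _ => h1 i) (mul_le_mul_of_nonneg_left h2 hs0)
      _ = (Fintype.card ι * (R' * C') + s * (R * C)) * ‖v‖ ^ 2 := by
          rw [Finset.sum_const, Finset.card_univ, nsmul_eq_mul]; ring
      _ ≤ (Fintype.card ι * (R' * C') + s * (R * C)) * (energyNorm c e s v ^ 2 / s) :=
          mul_le_mul_of_nonneg_left hv2
            (add_nonneg (mul_nonneg (Nat.cast_nonneg _) hRC') (mul_nonneg hs0 hRC))
      _ = (Fintype.card ι * (R' * C') / s + R * C) * energyNorm c e s v ^ 2 := by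
          field_simp
      _ ≤ Θ ^ 2 * energyNorm c e s v ^ 2 := mul_le_mul_of_nonneg_right hΘ (sq_nonneg _)
  exact (abs_le_of_sq_le_sq' hsq (mul_nonneg hΘ0 (energyNorm_nonneg c e s v))).2

omit [AddCommGroup G] [Fintype G] [DecidableEq G] [Fintype ι] in
/-- The conjugation defect of a kernel operator is the kernel operator with kernel `(ω(x)/ω(y) − 1)·p(x,y)`.
[folklore] -/
theorem conj_kernelOp_sub_apply [Fintype G] (ω : G → ℝ) (p : G → G → ℝ) (h : EuclideanSpace ℝ G) :
    (mulOp ω ∘ₗ kernelOp p ∘ₗ mulOp (fun x => (ω x)⁻¹) - kernelOp p) h =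
      kernelOp (fun x y => (ω x * (ω y)⁻¹ - 1) * p x y) h := by
  ext x
  simp only [LinearMap.sub_apply, LinearMap.comp_apply, PiLp.sub_apply, mulOp_apply, kernelOp_apply]
  rw [Finset.mul_sum, ← Finset.sum_sub_distrib]
  exact Finset.sum_congr rfl fun y _ => by ring

/-- CHORD INEQUALITY (convexity of `r ↦ e^{rt}` on `[0, a]`): `e^{νt} − 1 ≤ (ν/a)(e^{at} − 1)` for `0 ≤ ν ≤ a`,
`0 < a`. [folklore] -/
theorem exp_mul_sub_one_le_chord {ν a : ℝ} (hν : 0 ≤ ν) (hνa : ν ≤ a) (ha : 0 < a) (t : ℝ) :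
    Real.exp (ν * t) - 1 ≤ ν / a * (Real.exp (a * t) - 1) := by
  have h1 : 0 ≤ 1 - ν / a := by rw [sub_nonneg, div_le_one ha]; exact hνa
  have key := convexOn_exp.2 (Set.mem_univ (0:ℝ)) (Set.mem_univ (a * t)) h1 (div_nonneg hν ha.le) (by ring)
  simp only [smul_eq_mul, mul_zero, zero_add, Real.exp_zero, mul_one] at key
  have h2 : ν / a * (a * t) = ν * t := by field_simp
  rw [h2] at key
  linarith

/-- Ratio of a log-Lipschitz weight: `|log ω(x) − log ω(y)| ≤ ν d`, `0 ≤ ν ≤ a`, `d ≥ 0` give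
`|ω(x)/ω(y) − 1| ≤ (ν/a)·e^{a d}` and `ω(x)/ω(y) ≤ e^{a d}`. [folklore] -/
theorem weight_ratio_bounds {ωx ωy ν a d : ℝ} (hx : 0 < ωx) (hy : 0 < ωy) (hν : 0 ≤ ν) (hνa : ν ≤ a)
    (ha : 0 < a) (hd : 0 ≤ d) (hlog : |Real.log ωx - Real.log ωy| ≤ ν * d) :
    |ωx * ωy⁻¹ - 1| ≤ ν / a * Real.exp (a * d) ∧ ωx * ωy⁻¹ ≤ Real.exp (a * d) := by
  have hL : ωx * ωy⁻¹ = Real.exp (Real.log ωx - Real.log ωy) := by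
    rw [Real.exp_sub, Real.exp_log hx, Real.exp_log hy, div_eq_mul_inv]
  have hνd : ν * d ≤ a * d := mul_le_mul_of_nonneg_right hνa hd
  have hνa0 : 0 ≤ ν / a := div_nonneg hν ha.le
  rw [hL]
  -- `|e^L − 1| ≤ e^{|L|} − 1` (landed elsewhere in the library as
  -- `Literature.Geometry.Lorentzian.Deformation.abs_exp_sub_one_le_exp_abs_sub_one`; two lines, not re-declared)
  have habs : ∀ L : ℝ, |Real.exp L - 1| ≤ Real.exp |L| - 1 := fun L =>
    abs_le.mpr ⟨by nlinarith [Real.add_one_le_exp |L|, Real.add_one_le_exp L, neg_abs_le L],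
      by linarith [Real.exp_le_exp.mpr (le_abs_self L)]⟩
  refine ⟨?_, ?_⟩
  · calc |Real.exp (Real.log ωx - Real.log ωy) - 1|
          ≤ Real.exp |Real.log ωx - Real.log ωy| - 1 := habs _
      _ ≤ Real.exp (ν * d) - 1 := by linarith [Real.exp_le_exp.mpr hlog]
      _ ≤ ν / a * (Real.exp (a * d) - 1) := exp_mul_sub_one_le_chord hν hνa ha d
      _ ≤ ν / a * Real.exp (a * d) := by nlinarith
  · calc Real.exp (Real.log ωx - Real.log ωy) ≤ Real.exp |Real.log ωx - Real.log ωy| :=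
          Real.exp_le_exp.mpr (le_abs_self _)
      _ ≤ Real.exp (a * d) := Real.exp_le_exp.mpr (hlog.trans hνd)

omit [Fintype G] [DecidableEq G] [Fintype ι] in
/-- Mesh-Lipschitz weights: `c²(ω(x+e_i) − ω(x))² ≤ μ²ω(x)²` gives `|c(ω(x+e_i) − ω(x))| ≤ μ ω(x)`. [folklore] -/
theorem weight_mesh_abs_le {c μ : ℝ} {ω : G → ℝ} {e : ι → G} (hpos : ∀ x, 0 < ω x) (hμ : 0 ≤ μ)
    (hω : ∀ i x, c ^ 2 * (ω (x + e i) - ω x) ^ 2 ≤ μ ^ 2 * ω x ^ 2 ∧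
      c ^ 2 * (ω (x + e i) - ω x) ^ 2 ≤ μ ^ 2 * ω (x + e i) ^ 2) (i : ι) (x : G) :
    |c * (ω (x + e i) - ω x)| ≤ μ * ω x := by
  have h := (hω i x).1
  have h' : (c * (ω (x + e i) - ω x)) ^ 2 ≤ (μ * ω x) ^ 2 := by rw [mul_pow, mul_pow]; exact h
  exact abs_le_of_sq_le_sq h' (mul_nonneg hμ (hpos x).le)

omit [Fintype G] [DecidableEq G] [Fintype ι] in
/-- The inverse of a mesh-Lipschitz weight is mesh-Lipschitz with the same rate (the two one-sided clauses swap).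
[folklore] -/
theorem weight_inv_mesh_lipschitz {c μ : ℝ} {ω : G → ℝ} {e : ι → G} (hpos : ∀ x, 0 < ω x)
    (hω : ∀ i x, c ^ 2 * (ω (x + e i) - ω x) ^ 2 ≤ μ ^ 2 * ω x ^ 2 ∧
      c ^ 2 * (ω (x + e i) - ω x) ^ 2 ≤ μ ^ 2 * ω (x + e i) ^ 2) (i : ι) (x : G) :
    c ^ 2 * ((ω (x + e i))⁻¹ - (ω x)⁻¹) ^ 2 ≤ μ ^ 2 * ((ω x)⁻¹) ^ 2 ∧
      c ^ 2 * ((ω (x + e i))⁻¹ - (ω x)⁻¹) ^ 2 ≤ μ ^ 2 * ((ω (x + e i))⁻¹) ^ 2 := by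
  have hx := hpos x
  have hx' := hpos (x + e i)
  obtain ⟨h1, h2⟩ := hω i x
  have hrepr : c ^ 2 * ((ω (x + e i))⁻¹ - (ω x)⁻¹) ^ 2 =
      (c ^ 2 * (ω (x + e i) - ω x) ^ 2) * ((ω x)⁻¹) ^ 2 * ((ω (x + e i))⁻¹) ^ 2 := by
    field_simp
    ring
  rw [hrepr]
  constructor
  · calc (c ^ 2 * (ω (x + e i) - ω x) ^ 2) * ((ω x)⁻¹) ^ 2 * ((ω (x + e i))⁻¹) ^ 2
          ≤ (μ ^ 2 * ω (x + e i) ^ 2) * ((ω x)⁻¹) ^ 2 * ((ω (x + e i))⁻¹) ^ 2 := by gcongr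
      _ = μ ^ 2 * ((ω x)⁻¹) ^ 2 := by field_simp
  · calc (c ^ 2 * (ω (x + e i) - ω x) ^ 2) * ((ω x)⁻¹) ^ 2 * ((ω (x + e i))⁻¹) ^ 2
          ≤ (μ ^ 2 * ω x ^ 2) * ((ω x)⁻¹) ^ 2 * ((ω (x + e i))⁻¹) ^ 2 := by gcongr
      _ = μ ^ 2 * ((ω (x + e i))⁻¹) ^ 2 := by field_simp

omit [DecidableEq G] in
/-- (δ5) IN THE MODEL — CONJUGATION DEFECT OF AN EXPONENTIALLY LOCALISED KERNEL IN THE ENERGY GAUGE.  Data: a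
separation gauge `d ≥ 0` on sites; a weight `ω > 0` that is log-Lipschitz along `d` with rate `ν`
(`|log ω(x) − log ω(y)| ≤ ν d(x,y)`) and mesh-Lipschitz with rate `μ`; a kernel `p` whose rows and columns have
exponential moments at a rate `a ≥ ν`: `Σ|p(x,y)|e^{a d(x,y)} ≤ C_p` and, for the x-gradient kernel,
`Σ|c(p(x+e_i,y) − p(x,y))|e^{a d(x+e_i,y)} ≤ C_p′`.  Then the kernel `(ω(x)/ω(y) − 1)p(x,y)` of `ωPω⁻¹ − P` has
Schur bounds `(ν/a)C_p` and its x-gradient kernel `(ν/a)C_p′ + μC_p` (Leibniz: `c∇ₓ[(ω(x)/ω(y) − 1)p] =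
(ω(x+e_i)/ω(y) − 1)c∇ₓp + c∇ω(x)/ω(y)·p`, with `|ω(x)/ω(y) − 1| ≤ (ν/a)e^{a d}`, `ω(x)/ω(y) ≤ e^{a d}`), hence
`N_s((ωPω⁻¹ − P)h) ≤ Θ N_s(h)` whenever `#ι((ν/a)C_p′ + μC_p)²/s + ((ν/a)C_p)² ≤ Θ²`: the defect is `O(ν + μ)`,
free of the mesh and of the volume.  Dictionary: `P` = the projection onto the tangent space of the constraints
built from the operator `H` of (45) p. 285; its moments are an input of printed TYPE. [folklore]
[cite: Balaban1985Variational, (44)–(47) p. 285, (63)–(73) pp. 287–289 (context: H and the pseudo-locality of the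
kernels)] -/
theorem kernel_conjugationDefect_energy_le (c : ℝ) (e : ι → G) {s : ℝ} (hs : 0 < s)
    (ω : G → ℝ) (hpos : ∀ x, 0 < ω x) {μ : ℝ} (hμ : 0 ≤ μ)
    (hω : ∀ i x, c ^ 2 * (ω (x + e i) - ω x) ^ 2 ≤ μ ^ 2 * ω x ^ 2 ∧
      c ^ 2 * (ω (x + e i) - ω x) ^ 2 ≤ μ ^ 2 * ω (x + e i) ^ 2)
    (d : G → G → ℝ) (hd : ∀ x y, 0 ≤ d x y) {ν a : ℝ} (hν : 0 ≤ ν) (hνa : ν ≤ a) (ha : 0 < a)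
    (hlog : ∀ x y, |Real.log (ω x) - Real.log (ω y)| ≤ ν * d x y)
    (p : G → G → ℝ) {Cp Cp' : ℝ} (hCp : 0 ≤ Cp) (hCp' : 0 ≤ Cp')
    (hrow : ∀ x, ∑ y, |p x y| * Real.exp (a * d x y) ≤ Cp)
    (hcol : ∀ y, ∑ x, |p x y| * Real.exp (a * d x y) ≤ Cp)
    (hrow' : ∀ i x, ∑ y, |c * (p (x + e i) y - p x y)| * Real.exp (a * d (x + e i) y) ≤ Cp')
    (hcol' : ∀ i y, ∑ x, |c * (p (x + e i) y - p x y)| * Real.exp (a * d (x + e i) y) ≤ Cp')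
    {Θ : ℝ} (hΘ0 : 0 ≤ Θ)
    (hΘ : Fintype.card ι * (ν / a * Cp' + μ * Cp) ^ 2 / s + (ν / a * Cp) ^ 2 ≤ Θ ^ 2)
    (h : EuclideanSpace ℝ G) :
    energyNorm c e s ((mulOp ω ∘ₗ kernelOp p ∘ₗ mulOp (fun x => (ω x)⁻¹) - kernelOp p) h) ≤
      Θ * energyNorm c e s h := by
  rw [conj_kernelOp_sub_apply]
  set D : G → G → ℝ := fun x y => (ω x * (ω y)⁻¹ - 1) * p x y with hD
  have hνa0 : 0 ≤ ν / a := div_nonneg hν ha.le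
  -- pointwise bounds
  have hDpt : ∀ x y, |D x y| ≤ ν / a * (|p x y| * Real.exp (a * d x y)) := fun x y => by
    have hb := (weight_ratio_bounds (hpos x) (hpos y) hν hνa ha (hd x y) (hlog x y)).1
    rw [hD, abs_mul]
    calc |ω x * (ω y)⁻¹ - 1| * |p x y| ≤ ν / a * Real.exp (a * d x y) * |p x y| :=
          mul_le_mul_of_nonneg_right hb (abs_nonneg _)
      _ = ν / a * (|p x y| * Real.exp (a * d x y)) := by ring
  have hGpt : ∀ i x y, |c * (D (x + e i) y - D x y)| ≤
      ν / a * (|c * (p (x + e i) y - p x y)| * Real.exp (a * d (x + e i) y))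
        + μ * (|p x y| * Real.exp (a * d x y)) := fun i x y => by
    have hb1 := (weight_ratio_bounds (hpos (x + e i)) (hpos y) hν hνa ha (hd (x + e i) y) (hlog (x + e i) y)).1
    have hb2 := (weight_ratio_bounds (hpos x) (hpos y) hν hνa ha (hd x y) (hlog x y)).2
    have hb3 := weight_mesh_abs_le hpos hμ hω i x
    have hsplit : c * (D (x + e i) y - D x y) =
        (ω (x + e i) * (ω y)⁻¹ - 1) * (c * (p (x + e i) y - p x y))
          + c * (ω (x + e i) - ω x) * (ω y)⁻¹ * p x y := by
      simp only [hD]; ring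
    rw [hsplit]
    refine (abs_add_le _ _).trans (add_le_add ?_ ?_)
    · rw [abs_mul]
      calc |ω (x + e i) * (ω y)⁻¹ - 1| * |c * (p (x + e i) y - p x y)|
            ≤ ν / a * Real.exp (a * d (x + e i) y) * |c * (p (x + e i) y - p x y)| :=
            mul_le_mul_of_nonneg_right hb1 (abs_nonneg _)
        _ = _ := by ring
    · rw [abs_mul, abs_mul, abs_of_pos (inv_pos.mpr (hpos y))]
      have hy0 : 0 ≤ (ω y)⁻¹ := (inv_pos.mpr (hpos y)).le
      calc |c * (ω (x + e i) - ω x)| * (ω y)⁻¹ * |p x y| ≤ μ * ω x * (ω y)⁻¹ * |p x y| := by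
            gcongr
        _ = μ * (ω x * (ω y)⁻¹) * |p x y| := by ring
        _ ≤ μ * Real.exp (a * d x y) * |p x y| := by gcongr
        _ = μ * (|p x y| * Real.exp (a * d x y)) := by ring
  -- Schur data of D and of its gradient kernels
  have hDrow : ∀ x, ∑ y, |D x y| ≤ ν / a * Cp := fun x =>
    calc ∑ y, |D x y| ≤ ∑ y, ν / a * (|p x y| * Real.exp (a * d x y)) := Finset.sum_le_sum fun y _ => hDpt x y
      _ = ν / a * ∑ y, |p x y| * Real.exp (a * d x y) := by rw [Finset.mul_sum]
      _ ≤ ν / a * Cp := mul_le_mul_of_nonneg_left (hrow x) hνa0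
  have hDcol : ∀ y, ∑ x, |D x y| ≤ ν / a * Cp := fun y =>
    calc ∑ x, |D x y| ≤ ∑ x, ν / a * (|p x y| * Real.exp (a * d x y)) := Finset.sum_le_sum fun x _ => hDpt x y
      _ = ν / a * ∑ x, |p x y| * Real.exp (a * d x y) := by rw [Finset.mul_sum]
      _ ≤ ν / a * Cp := mul_le_mul_of_nonneg_left (hcol y) hνa0
  have hGrow : ∀ i x, ∑ y, |c * (D (x + e i) y - D x y)| ≤ ν / a * Cp' + μ * Cp := fun i x =>
    calc ∑ y, |c * (D (x + e i) y - D x y)|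
        ≤ ∑ y, (ν / a * (|c * (p (x + e i) y - p x y)| * Real.exp (a * d (x + e i) y))
            + μ * (|p x y| * Real.exp (a * d x y))) := Finset.sum_le_sum fun y _ => hGpt i x y
      _ = ν / a * ∑ y, |c * (p (x + e i) y - p x y)| * Real.exp (a * d (x + e i) y)
            + μ * ∑ y, |p x y| * Real.exp (a * d x y) := by
          rw [Finset.sum_add_distrib, Finset.mul_sum, Finset.mul_sum]
      _ ≤ ν / a * Cp' + μ * Cp :=
          add_le_add (mul_le_mul_of_nonneg_left (hrow' i x) hνa0) (mul_le_mul_of_nonneg_left (hrow x) hμ)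
  have hGcol : ∀ i y, ∑ x, |c * (D (x + e i) y - D x y)| ≤ ν / a * Cp' + μ * Cp := fun i y =>
    calc ∑ x, |c * (D (x + e i) y - D x y)|
        ≤ ∑ x, (ν / a * (|c * (p (x + e i) y - p x y)| * Real.exp (a * d (x + e i) y))
            + μ * (|p x y| * Real.exp (a * d x y))) := Finset.sum_le_sum fun x _ => hGpt i x y
      _ = ν / a * ∑ x, |c * (p (x + e i) y - p x y)| * Real.exp (a * d (x + e i) y)
            + μ * ∑ x, |p x y| * Real.exp (a * d x y) := by
          rw [Finset.sum_add_distrib, Finset.mul_sum, Finset.mul_sum]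
      _ ≤ ν / a * Cp' + μ * Cp :=
          add_le_add (mul_le_mul_of_nonneg_left (hcol' i y) hνa0) (mul_le_mul_of_nonneg_left (hcol y) hμ)
  exact energyNorm_kernelOp_le c e hs D (by positivity) (by positivity) (by positivity) (by positivity)
    hDrow hDcol hGrow hGcol hΘ0 ((le_of_eq (by ring)).trans hΘ) h

end KernelSchur

section ProjectorLattice

variable {G : Type*} [AddCommGroup G] [Fintype G] {ι : Type*} [Fintype ι]

/-- ASSEMBLED LATTICE THEOREM WITH AN ARBITRARY TANGENT SPACE AND PROJECTOR ((δ5)-ready form of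
`constrained_lattice_agmon_of_le`).  `T ≤ ℓ²(G)` is ANY subspace (dictionary: averaging constraints AND the gauge
condition), `P` ANY linear projector onto it; the block/profile apparatus is replaced by the two conjugation-defect
bounds `hda`, `hdb` of `P` in the energy gauge (finite-range instance: `tangentProj`, priced by
`blockCorr_energy_le`; exponentially localised instance: `kernel_conjugationDefect_energy_le`).  Sub-mass form
`B = latticeForm c e s₀`, `0 ≤ s₀ ≤ s`, gauge `N_s`, coercivity on `T` only (`hcoerT`, the ML slot), mesh-Lipschitz
weight; conclusion `N_s(ωu) ≤ ρ(1 + θa + θb)/(m(1−θa)² − θa(2+θa) − #ι·μ²/s − (1 + μ√(#ι/s))²(θa + θb))`.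
[folklore] [cite: Balaban1985Variational, (45) p. 285, (79)–(84) p. 290 (context)] -/
theorem constrained_lattice_agmon_projector (c : ℝ) (e : ι → G) {s μ θa θb ρ : ℝ} (hs : 0 < s)
    (ω : G → ℝ) (hpos : ∀ x, 0 < ω x) (hμ : 0 ≤ μ)
    (hω : ∀ i x, c ^ 2 * (ω (x + e i) - ω x) ^ 2 ≤ μ ^ 2 * ω x ^ 2 ∧
      c ^ 2 * (ω (x + e i) - ω x) ^ 2 ≤ μ ^ 2 * ω (x + e i) ^ 2)
    (T : Submodule ℝ (EuclideanSpace ℝ G)) (P : EuclideanSpace ℝ G →ₗ[ℝ] EuclideanSpace ℝ G)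
    (hPT : ∀ v ∈ T, P v = v) (hPr : ∀ h, P h ∈ T)
    (hθa0 : 0 ≤ θa) (hθa1 : θa ≤ 1) (hθb0 : 0 ≤ θb)
    (hda : ∀ h, energyNorm c e s ((mulOp ω ∘ₗ P ∘ₗ mulOp (fun x => (ω x)⁻¹) - P) h) ≤
      θa * energyNorm c e s h)
    (hdb : ∀ h, energyNorm c e s ((P - mulOp (fun x => (ω x)⁻¹) ∘ₗ P ∘ₗ mulOp ω) h) ≤
      θb * energyNorm c e s h)
    {s₀ m : ℝ} (hs₀ : 0 ≤ s₀) (hs₀s : s₀ ≤ s) (hm0 : 0 ≤ m)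
    (hcoerT : ∀ v ∈ T, m * energyNorm c e s v ^ 2 ≤ latticeForm c e s₀ v v)
    (hden : Fintype.card ι * μ ^ 2 / s + (1 + μ * Real.sqrt (Fintype.card ι / s)) ^ 2 * (θa + θb)
      + θa * (2 + θa) < m * (1 - θa) ^ 2)
    {u : EuclideanSpace ℝ G} (hu : u ∈ T) (J : EuclideanSpace ℝ G →ₗ[ℝ] ℝ) (hρ : 0 ≤ ρ)
    (hweak : ∀ v ∈ T, latticeForm c e s₀ u v = J v)
    (hJ : ∀ v, |J (mulOp ω v)| ≤ ρ * energyNorm c e s v) :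
    energyNorm c e s (mulOp ω u) ≤ (ρ + ρ * (θa + θb)) /
      (m * (1 - θa) ^ 2 - θa * (2 + θa) - Fintype.card ι * μ ^ 2 / s
        - (1 + μ * Real.sqrt (Fintype.card ι / s)) ^ 2 * (θa + θb)) := by
  have key := agmon_constrained_tangent_projector (latticeForm c e s₀) (mulOp ω)
    (mulOp (fun x => (ω x)⁻¹)) P T (energyNorm c e s) J (m := m) (Λ := 1)
    (Λw := (1 + μ * Real.sqrt (Fintype.card ι / s)) ^ 2)
    (κ := Fintype.card ι * μ ^ 2 / s) (θa := θa) (θb := θb) (ρ := ρ)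
    (by linarith) hm0 zero_le_one (by positivity) hθa0 hθa1 hθb0 hρ hcoerT
    (fun v h => by rw [one_mul]; exact latticeForm_abs_le_of_le c e hs₀ hs₀s v h)
    (energyNorm_sub_rev c e hs.le) (energyNorm_nonneg c e s)
    (latticeForm_conjugationDefect_energy_of_le c e s₀ hs ω hω)
    (mulOp_inv_mul ω hpos) hPT hPr hda hdb hu
    (fun h => by
      have := latticeForm_weighted_continuity_of_le c e hs₀ hs₀s hs ω hpos hμ hω u h
      simpa only [mul_assoc] using this)
    (fun h => by
      have := hJ (mulOp (fun x => (ω x)⁻¹) h)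
      rwa [mulOp_mul_inv ω hpos] at this)
    hweak
  simpa only [one_mul] using key

/-- (δ5) IN THE MODEL, FULLY DISCHARGED: `constrained_lattice_agmon_projector` with a KERNEL projector `P = T_p` onto
an arbitrary tangent space `T`, exponentially localised as in `kernel_conjugationDefect_energy_le` (moments `C_p`,
`C_p′` at a rate `a`), and an Agmon weight log-Lipschitz along the separation gauge with rate `ν ≤ a` and
mesh-Lipschitz with rate `μ`: both conjugation defects are `≤ Θ` with `#ι((ν/a)C_p′ + μC_p)²/s + ((ν/a)C_p)² ≤ Θ²`
(the bound for `ω⁻¹` is the bound for `ω`: `weight_inv_mesh_lipschitz`, `log ω⁻¹ = −log ω`), so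
`N_s(ωu) ≤ ρ(1 + 2Θ)/(m(1−Θ)² − Θ(2+Θ) − #ι·μ²/s − 2(1 + μ√(#ι/s))²Θ)`.  Every constant is free of the mesh and
the volume; the Agmon rates `ν, μ` must be small against the localisation rate `a` and the moments of the projector.
What is NOT here: the construction of such a `p` for Bałaban's constraints (printed TYPE (45)–(46) p. 285,
(63)–(73) pp. 287–289), vector values, ML. [folklore]
[cite: Balaban1985Variational, (44)–(47) p. 285, (63)–(73) pp. 287–289, (79)–(84) p. 290 (context)] -/
theorem constrained_lattice_agmon_localized (c : ℝ) (e : ι → G) {s μ ρ : ℝ} (hs : 0 < s)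
    (ω : G → ℝ) (hpos : ∀ x, 0 < ω x) (hμ : 0 ≤ μ)
    (hω : ∀ i x, c ^ 2 * (ω (x + e i) - ω x) ^ 2 ≤ μ ^ 2 * ω x ^ 2 ∧
      c ^ 2 * (ω (x + e i) - ω x) ^ 2 ≤ μ ^ 2 * ω (x + e i) ^ 2)
    (d : G → G → ℝ) (hd : ∀ x y, 0 ≤ d x y) {ν a : ℝ} (hν : 0 ≤ ν) (hνa : ν ≤ a) (ha : 0 < a)
    (hlog : ∀ x y, |Real.log (ω x) - Real.log (ω y)| ≤ ν * d x y)
    (T : Submodule ℝ (EuclideanSpace ℝ G)) (p : G → G → ℝ)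
    (hPT : ∀ v ∈ T, kernelOp p v = v) (hPr : ∀ h, kernelOp p h ∈ T)
    {Cp Cp' : ℝ} (hCp : 0 ≤ Cp) (hCp' : 0 ≤ Cp')
    (hrow : ∀ x, ∑ y, |p x y| * Real.exp (a * d x y) ≤ Cp)
    (hcol : ∀ y, ∑ x, |p x y| * Real.exp (a * d x y) ≤ Cp)
    (hrow' : ∀ i x, ∑ y, |c * (p (x + e i) y - p x y)| * Real.exp (a * d (x + e i) y) ≤ Cp')
    (hcol' : ∀ i y, ∑ x, |c * (p (x + e i) y - p x y)| * Real.exp (a * d (x + e i) y) ≤ Cp')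
    {Θ : ℝ} (hΘ0 : 0 ≤ Θ) (hΘ1 : Θ ≤ 1)
    (hΘ : Fintype.card ι * (ν / a * Cp' + μ * Cp) ^ 2 / s + (ν / a * Cp) ^ 2 ≤ Θ ^ 2)
    {s₀ m : ℝ} (hs₀ : 0 ≤ s₀) (hs₀s : s₀ ≤ s) (hm0 : 0 ≤ m)
    (hcoerT : ∀ v ∈ T, m * energyNorm c e s v ^ 2 ≤ latticeForm c e s₀ v v)
    (hden : Fintype.card ι * μ ^ 2 / s + (1 + μ * Real.sqrt (Fintype.card ι / s)) ^ 2 * (Θ + Θ)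
      + Θ * (2 + Θ) < m * (1 - Θ) ^ 2)
    {u : EuclideanSpace ℝ G} (hu : u ∈ T) (J : EuclideanSpace ℝ G →ₗ[ℝ] ℝ) (hρ : 0 ≤ ρ)
    (hweak : ∀ v ∈ T, latticeForm c e s₀ u v = J v)
    (hJ : ∀ v, |J (mulOp ω v)| ≤ ρ * energyNorm c e s v) :
    energyNorm c e s (mulOp ω u) ≤ (ρ + ρ * (Θ + Θ)) /
      (m * (1 - Θ) ^ 2 - Θ * (2 + Θ) - Fintype.card ι * μ ^ 2 / s
        - (1 + μ * Real.sqrt (Fintype.card ι / s)) ^ 2 * (Θ + Θ)) := by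
  have hs0 := hs.le
  -- defect of ω
  have hda := kernel_conjugationDefect_energy_le c e hs ω hpos hμ hω d hd hν hνa ha hlog p hCp hCp'
    hrow hcol hrow' hcol' hΘ0 hΘ
  -- defect of ω⁻¹: same data
  have hpos' : ∀ x, 0 < (ω x)⁻¹ := fun x => inv_pos.mpr (hpos x)
  have hω' := weight_inv_mesh_lipschitz hpos hω
  have hlog' : ∀ x y, |Real.log (ω x)⁻¹ - Real.log (ω y)⁻¹| ≤ ν * d x y := fun x y => by
    rw [Real.log_inv, Real.log_inv, show -Real.log (ω x) - -Real.log (ω y) =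
      -(Real.log (ω x) - Real.log (ω y)) by ring, abs_neg]
    exact hlog x y
  have hdb0 := kernel_conjugationDefect_energy_le c e hs (fun x => (ω x)⁻¹) hpos' hμ hω' d hd hν hνa ha
    hlog' p hCp hCp' hrow hcol hrow' hcol' hΘ0 hΘ
  have hdb : ∀ h, energyNorm c e s ((kernelOp p - mulOp (fun x => (ω x)⁻¹) ∘ₗ kernelOp p ∘ₗ mulOp ω) h) ≤
      Θ * energyNorm c e s h := fun h => by
    have h1 := hdb0 h
    simp only [inv_inv] at h1
    have h2 : (kernelOp p - mulOp (fun x => (ω x)⁻¹) ∘ₗ kernelOp p ∘ₗ mulOp ω) h =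
        -((mulOp (fun x => (ω x)⁻¹) ∘ₗ kernelOp p ∘ₗ mulOp (fun x => ω x) - kernelOp p) h) := by
      simp only [LinearMap.sub_apply, neg_sub]
    rw [h2, energyNorm_neg c e hs0]
    exact h1
  exact constrained_lattice_agmon_projector c e hs ω hpos hμ hω T (kernelOp p) hPT hPr hΘ0 hΘ1 hΘ0 hda hdb
    hs₀ hs₀s hm0 hcoerT hden hu J hρ hweak hJ

/-- NON-VACUITY of the smallness conditions of `constrained_lattice_agmon_localized` in four directions:
`(s, μ, ν/a, C_p, C_p′, Θ, m) = (1, 10⁻³, 10⁻³, 10, 10, 1/20, 1/2)` (m = 1/(1+s) as in `coercive_blockTangent_4D`).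
[folklore] -/
example :
    (4:ℝ) * ((1:ℝ) / 1000 * 10 + 1 / 1000 * 10) ^ 2 / 1 + ((1:ℝ) / 1000 * 10) ^ 2 ≤ (1 / 20) ^ 2 ∧
    4 * ((1:ℝ) / 1000) ^ 2 / 1 + (1 + 1 / 1000 * Real.sqrt (4 / 1)) ^ 2 * (1 / 20 + 1 / 20)
      + 1 / 20 * (2 + 1 / 20) < 1 / 2 * (1 - 1 / 20) ^ 2 := by
  refine ⟨by norm_num, ?_⟩
  have : Real.sqrt (4 / 1) = 2 := by
    rw [div_one, show (4:ℝ) = 2 ^ 2 by norm_num, Real.sqrt_sq (by norm_num)]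
  rw [this]
  norm_num

end ProjectorLattice

/-! ## §7 (v1.2) Kernel terms in the form ((δ3) at model level)

The Hessian of the dictionary ((79)–(80) p. 290) is a covariant difference form PLUS block kernel terms (HD(A′),
Δ_π, the V-terms) of printed-TYPE size and localisation.  The Agmon mechanism of §6 tolerates any additive kernel
term `P_t` whose kernel has exponential moments `Σ_y|t(x,y)|e^{a d(x,y)} ≤ C_t` (rows and columns, symmetric
separation gauge `d`) at a localisation rate `a ≥ ν`: plain continuity `Λ = 1 + C_t/s` (`kernelForm_abs_le`,
`norm_mul_norm_le_energy`), conjugation defect `κ = #ι·μ²/s + (ν/a)C_t/s` (`kernelForm_conjugationDefect_localized`,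
from `kernelForm_conjugationDefect` of `T4ConvexResponse` and `weight_ratio_bounds`), weighted continuity
`Λ_w = (1 + μ√(#ι/s))² + C_t/s` (`kernelForm_weighted_abs_le`, via the change of gauge
`P_t(u,h) = P_{t·ω(y)/ω(x)}(ωu, ω⁻¹h)`), and the coercivity hypothesis is placed on the FULL form `B_{s₀} + P_t` (the
ML slot concerns the Hessian itself): `constrained_lattice_agmon_kernelTerm`.  All [folklore]; the VALUES of `C_t`
for Bałaban's block operators are the dictionary item (δ3) (printed TYPE, (80) p. 290) and are NOT supplied here. -/

section KernelTerms

variable {G : Type*} [AddCommGroup G] [Fintype G] {ι : Type*} [Fintype ι]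

omit [AddCommGroup G] in
/-- `P_t(v, h) = ⟨v, T_t h⟩`. [folklore] -/
theorem kernelForm_eq_inner (t : G → G → ℝ) (v h : EuclideanSpace ℝ G) :
    kernelForm t v h = inner ℝ v (kernelOp t h) := by
  simp only [kernelForm, LinearMap.compl₁₂_apply, LinearMap.id_apply, innerₗ_apply_apply]

omit [AddCommGroup G] in
/-- OFF-DIAGONAL SCHUR BOUND: row and column sums of `|t|` at most `T` give `|P_t(v, h)| ≤ T‖v‖‖h‖`. [folklore] -/
theorem kernelForm_abs_le (t : G → G → ℝ) {T : ℝ} (hT : 0 ≤ T) (hrow : ∀ x, ∑ y, |t x y| ≤ T)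
    (hcol : ∀ y, ∑ x, |t x y| ≤ T) (v h : EuclideanSpace ℝ G) :
    |kernelForm t v h| ≤ T * ‖v‖ * ‖h‖ := by
  rw [kernelForm_eq_inner]
  have h2 : ‖kernelOp t h‖ ≤ T * ‖h‖ := by
    have h1 : ‖kernelOp t h‖ ^ 2 ≤ (T * ‖h‖) ^ 2 := by
      calc ‖kernelOp t h‖ ^ 2 ≤ T * T * ‖h‖ ^ 2 := norm_kernelOp_sq_le t hT hrow hcol h
        _ = (T * ‖h‖) ^ 2 := by ring
    exact (pow_le_pow_iff_left₀ (norm_nonneg _) (mul_nonneg hT (norm_nonneg _)) two_ne_zero).mp h1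
  calc |inner ℝ v (kernelOp t h)| ≤ ‖v‖ * ‖kernelOp t h‖ := abs_real_inner_le_norm _ _
    _ ≤ ‖v‖ * (T * ‖h‖) := mul_le_mul_of_nonneg_left h2 (norm_nonneg _)
    _ = T * ‖v‖ * ‖h‖ := by ring

/-- The mass part of the energy gauge controls products of ℓ² norms: `‖v‖‖h‖ ≤ N_s(v)N_s(h)/s`. [folklore] -/
theorem norm_mul_norm_le_energy (c : ℝ) (e : ι → G) {s : ℝ} (hs : 0 < s) (v h : EuclideanSpace ℝ G) :
    ‖v‖ * ‖h‖ ≤ energyNorm c e s v * energyNorm c e s h / s := by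
  have hv := norm_sq_le_energyNorm_sq c e hs.le v
  have hh := norm_sq_le_energyNorm_sq c e hs.le h
  have hNv := energyNorm_nonneg c e s v
  have hNh := energyNorm_nonneg c e s h
  rw [le_div_iff₀ hs]
  have h1 : (‖v‖ * ‖h‖ * s) ^ 2 ≤ (energyNorm c e s v * energyNorm c e s h) ^ 2 := by
    calc (‖v‖ * ‖h‖ * s) ^ 2 = (s * ‖v‖ ^ 2) * (s * ‖h‖ ^ 2) := by ring
      _ ≤ energyNorm c e s v ^ 2 * energyNorm c e s h ^ 2 :=
          mul_le_mul hv hh (by positivity) (sq_nonneg _)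
      _ = (energyNorm c e s v * energyNorm c e s h) ^ 2 := by ring
  exact (pow_le_pow_iff_left₀ (by positivity) (mul_nonneg hNv hNh) two_ne_zero).mp h1

omit [AddCommGroup G] in
/-- Change of gauge in a kernel form: `P_t(u, h) = P_{t̃}(ωu, ω⁻¹h)` with `t̃(x,y) = t(x,y)·ω(y)/ω(x)`. [folklore] -/
theorem kernelForm_reweight (t : G → G → ℝ) (ω : G → ℝ) (hpos : ∀ x, 0 < ω x) (u h : EuclideanSpace ℝ G) :
    kernelForm t u h = kernelForm (fun x y => t x y * (ω y * (ω x)⁻¹)) (mulOp ω u)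
      (mulOp (fun x => (ω x)⁻¹) h) := by
  rw [kernelForm_apply, kernelForm_apply]
  refine Finset.sum_congr rfl fun x _ => Finset.sum_congr rfl fun y _ => ?_
  have hx := (hpos x).ne'
  have hy := (hpos y).ne'
  simp only [mulOp_apply]
  field_simp

/-- WEIGHTED CONTINUITY OF A LOCALISED KERNEL TERM: symmetric separation gauge `d ≥ 0`, weight log-Lipschitz
along `d` with rate `ν ≤ a`, exponential moments `C_t` of `t` at rate `a` (rows and columns) ⇒
`|P_t(u, h)| ≤ (C_t/s)·N_s(ωu)·N_s(ω⁻¹h)` (pointwise `ω(y)/ω(x) ≤ e^{a d(x,y)}`, `weight_ratio_bounds`). [folklore] -/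
theorem kernelForm_weighted_abs_le (c : ℝ) (e : ι → G) {s : ℝ} (hs : 0 < s) (ω : G → ℝ) (hpos : ∀ x, 0 < ω x)
    (d : G → G → ℝ) (hd : ∀ x y, 0 ≤ d x y) (hdsym : ∀ x y, d x y = d y x) {ν a : ℝ} (hν : 0 ≤ ν)
    (hνa : ν ≤ a) (ha : 0 < a) (hlog : ∀ x y, |Real.log (ω x) - Real.log (ω y)| ≤ ν * d x y)
    (t : G → G → ℝ) {Ct : ℝ} (hCt : 0 ≤ Ct)
    (hrow : ∀ x, ∑ y, |t x y| * Real.exp (a * d x y) ≤ Ct) (hcol : ∀ y, ∑ x, |t x y| * Real.exp (a * d x y) ≤ Ct)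
    (u h : EuclideanSpace ℝ G) :
    |kernelForm t u h| ≤
      Ct / s * (energyNorm c e s (mulOp ω u) * energyNorm c e s (mulOp (fun x => (ω x)⁻¹) h)) := by
  rw [kernelForm_reweight t ω hpos]
  set tt : G → G → ℝ := fun x y => t x y * (ω y * (ω x)⁻¹) with htt
  have hpt : ∀ x y, |tt x y| ≤ |t x y| * Real.exp (a * d x y) := fun x y => by
    have hb := (weight_ratio_bounds (hpos y) (hpos x) hν hνa ha (hd y x) (hlog y x)).2
    rw [hdsym y x] at hb
    rw [htt, abs_mul, abs_of_pos (mul_pos (hpos y) (inv_pos.mpr (hpos x)))]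
    exact mul_le_mul_of_nonneg_left hb (abs_nonneg _)
  have hrow' : ∀ x, ∑ y, |tt x y| ≤ Ct := fun x => (Finset.sum_le_sum fun y _ => hpt x y).trans (hrow x)
  have hcol' : ∀ y, ∑ x, |tt x y| ≤ Ct := fun y => (Finset.sum_le_sum fun x _ => hpt x y).trans (hcol y)
  have h1 := kernelForm_abs_le tt hCt hrow' hcol' (mulOp ω u) (mulOp (fun x => (ω x)⁻¹) h)
  have h2 := norm_mul_norm_le_energy c e hs (mulOp ω u) (mulOp (fun x => (ω x)⁻¹) h)
  calc |kernelForm tt (mulOp ω u) (mulOp (fun x => (ω x)⁻¹) h)|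
      ≤ Ct * (‖mulOp ω u‖ * ‖mulOp (fun x => (ω x)⁻¹) h‖) := by rw [← mul_assoc]; exact h1
    _ ≤ Ct * (energyNorm c e s (mulOp ω u) * energyNorm c e s (mulOp (fun x => (ω x)⁻¹) h) / s) :=
        mul_le_mul_of_nonneg_left h2 hCt
    _ = _ := by ring

/-- A conjugation defect `κ‖·‖²` (`κ ≥ 0`) is a conjugation defect `κ/s` in the energy gauge `N_s`, `s > 0`.
[folklore] -/
theorem conjugationDefect_energy_of_norm (c : ℝ) (e : ι → G) {s : ℝ} (hs : 0 < s)
    (B : EuclideanSpace ℝ G →ₗ[ℝ] EuclideanSpace ℝ G →ₗ[ℝ] ℝ) (ω : G → ℝ) {κ : ℝ} (hκ : 0 ≤ κ)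
    (h : ConjugationDefect B (mulOp ω) (fun v => ‖v‖) κ) :
    ConjugationDefect B (mulOp ω) (energyNorm c e s) (κ / s) := by
  intro u
  have h1 := h u
  have hn := norm_sq_le_energyNorm_sq c e hs.le (mulOp ω u)
  have h2 : κ * ‖mulOp ω u‖ ^ 2 ≤ κ / s * energyNorm c e s (mulOp ω u) ^ 2 := by
    rw [div_mul_eq_mul_div, le_div_iff₀ hs]
    nlinarith
  simp only at h1
  linarith

/-- CONJUGATION DEFECT OF A LOCALISED KERNEL TERM in the energy gauge: with the data of
`kernelForm_weighted_abs_le`, `ConjugationDefect (kernelForm t) (mulOp ω) N_s ((ν/a)C_t/s)` — pointwise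
`|ω(x) − ω(y)| ≤ (ν/a)e^{a d(x,y)}ω(x)`, then the AM–GM Schur bound `kernelForm_conjugationDefect` and the mass
part of the gauge. [folklore] -/
theorem kernelForm_conjugationDefect_localized (c : ℝ) (e : ι → G) {s : ℝ} (hs : 0 < s) (ω : G → ℝ)
    (hpos : ∀ x, 0 < ω x) (d : G → G → ℝ) (hd : ∀ x y, 0 ≤ d x y) (hdsym : ∀ x y, d x y = d y x)
    {ν a : ℝ} (hν : 0 ≤ ν) (hνa : ν ≤ a) (ha : 0 < a)
    (hlog : ∀ x y, |Real.log (ω x) - Real.log (ω y)| ≤ ν * d x y) (t : G → G → ℝ) {Ct : ℝ} (hCt : 0 ≤ Ct)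
    (hrow : ∀ x, ∑ y, |t x y| * Real.exp (a * d x y) ≤ Ct) (hcol : ∀ y, ∑ x, |t x y| * Real.exp (a * d x y) ≤ Ct) :
    ConjugationDefect (kernelForm t) (mulOp ω) (energyNorm c e s) (ν / a * Ct / s) := by
  have hνa0 : 0 ≤ ν / a := div_nonneg hν ha.le
  have hK : ConjugationDefect (kernelForm t) (mulOp ω) (fun v => ‖v‖) (ν / a * Ct) := by
    refine kernelForm_conjugationDefect t ω (fun x y => ν / a * (|t x y| * Real.exp (a * d x y)))
      (fun x y => by positivity) (fun x => ?_) (fun y => ?_) (fun x y => ?_)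
    · rw [← Finset.mul_sum]; exact mul_le_mul_of_nonneg_left (hrow x) hνa0
    · rw [← Finset.mul_sum]; exact mul_le_mul_of_nonneg_left (hcol y) hνa0
    · have hx := hpos x
      have hy := hpos y
      have hb := (weight_ratio_bounds hy hx hν hνa ha (hd y x) (hlog y x)).1
      rw [hdsym y x] at hb
      have hdiff : |ω x - ω y| ≤ ν / a * Real.exp (a * d x y) * ω x := by
        have hrepr : ω x - ω y = -(ω y * (ω x)⁻¹ - 1) * ω x := by
          field_simp
          ring
        rw [hrepr, abs_mul, abs_neg, abs_of_pos hx]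
        exact mul_le_mul_of_nonneg_right hb hx.le
      rw [abs_mul, abs_mul, abs_of_pos hx, abs_of_pos hy]
      calc |t x y| * (|ω x - ω y| * ω y) ≤ |t x y| * (ν / a * Real.exp (a * d x y) * ω x * ω y) :=
            mul_le_mul_of_nonneg_left (mul_le_mul_of_nonneg_right hdiff hy.le) (abs_nonneg _)
        _ = ν / a * (|t x y| * Real.exp (a * d x y)) * (ω x * ω y) := by ring
  exact conjugationDefect_energy_of_norm c e hs (kernelForm t) ω (mul_nonneg hνa0 hCt) hK

/-- (δ3) AT MODEL LEVEL: THE CONSTRAINED AGMON BOUND WITH A LOCALISED KERNEL TERM IN THE FORM.  The form is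
`B′ = B_{s₀} + P_t` (`0 ≤ s₀ ≤ s`, `0 < s`), `t` with exponential moments `C_t` at rate `a` along a symmetric
separation gauge `d ≥ 0`; the Agmon weight is mesh-Lipschitz (rate `μ`) and log-Lipschitz along `d` (rate `ν ≤ a`);
`T` an ARBITRARY subspace with a projector `P` of conjugation defects `θa`, `θb` in the energy gauge (as in
`constrained_lattice_agmon_projector`); coercivity `m·N_s² ≤ B′` on `T` (hypothesis — the ML slot, on the FULL
form); tangent-only weak equation `B′(u, ·) = J` on `T` with `|J(ωv)| ≤ ρN_s(v)`.  Then, with `Λ = 1 + C_t/s`,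
`κ = #ι·μ²/s + (ν/a)C_t/s`, `Λ_w = (1 + μ√(#ι/s))² + C_t/s` and the smallness
`κ + Λ_w(θa + θb) + Λθa(2 + θa) < m(1 − θa)²`:
`N_s(ωu) ≤ ρ(1 + θa + θb)/(m(1 − θa)² − Λθa(2 + θa) − κ − Λ_w(θa + θb))` — free of the mesh and the volume.
The VALUES of `C_t` (and of `θa`, `θb`) for Bałaban's block operators are dictionary items ((δ3), (δ5): printed
TYPE) and are NOT supplied here; scalar values; ML untouched. [folklore]
[cite: Balaban1985Variational, (79)–(84) p. 290 (context)] -/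
theorem constrained_lattice_agmon_kernelTerm (c : ℝ) (e : ι → G) {s μ θa θb ρ : ℝ} (hs : 0 < s)
    (ω : G → ℝ) (hpos : ∀ x, 0 < ω x) (hμ : 0 ≤ μ)
    (hω : ∀ i x, c ^ 2 * (ω (x + e i) - ω x) ^ 2 ≤ μ ^ 2 * ω x ^ 2 ∧
      c ^ 2 * (ω (x + e i) - ω x) ^ 2 ≤ μ ^ 2 * ω (x + e i) ^ 2)
    (d : G → G → ℝ) (hd : ∀ x y, 0 ≤ d x y) (hdsym : ∀ x y, d x y = d y x) {ν a : ℝ} (hν : 0 ≤ ν)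
    (hνa : ν ≤ a) (ha : 0 < a) (hlog : ∀ x y, |Real.log (ω x) - Real.log (ω y)| ≤ ν * d x y)
    (t : G → G → ℝ) {Ct : ℝ} (hCt : 0 ≤ Ct)
    (htrow : ∀ x, ∑ y, |t x y| * Real.exp (a * d x y) ≤ Ct)
    (htcol : ∀ y, ∑ x, |t x y| * Real.exp (a * d x y) ≤ Ct)
    (T : Submodule ℝ (EuclideanSpace ℝ G)) (P : EuclideanSpace ℝ G →ₗ[ℝ] EuclideanSpace ℝ G)
    (hPT : ∀ v ∈ T, P v = v) (hPr : ∀ h, P h ∈ T)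
    (hθa0 : 0 ≤ θa) (hθa1 : θa ≤ 1) (hθb0 : 0 ≤ θb)
    (hda : ∀ h, energyNorm c e s ((mulOp ω ∘ₗ P ∘ₗ mulOp (fun x => (ω x)⁻¹) - P) h) ≤
      θa * energyNorm c e s h)
    (hdb : ∀ h, energyNorm c e s ((P - mulOp (fun x => (ω x)⁻¹) ∘ₗ P ∘ₗ mulOp ω) h) ≤
      θb * energyNorm c e s h)
    {s₀ m : ℝ} (hs₀ : 0 ≤ s₀) (hs₀s : s₀ ≤ s) (hm0 : 0 ≤ m)
    (hcoerT : ∀ v ∈ T, m * energyNorm c e s v ^ 2 ≤ (latticeForm c e s₀ + kernelForm t) v v)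
    (hden : Fintype.card ι * μ ^ 2 / s + ν / a * Ct / s
      + ((1 + μ * Real.sqrt (Fintype.card ι / s)) ^ 2 + Ct / s) * (θa + θb)
      + (1 + Ct / s) * θa * (2 + θa) < m * (1 - θa) ^ 2)
    {u : EuclideanSpace ℝ G} (hu : u ∈ T) (J : EuclideanSpace ℝ G →ₗ[ℝ] ℝ) (hρ : 0 ≤ ρ)
    (hweak : ∀ v ∈ T, (latticeForm c e s₀ + kernelForm t) u v = J v)
    (hJ : ∀ v, |J (mulOp ω v)| ≤ ρ * energyNorm c e s v) :
    energyNorm c e s (mulOp ω u) ≤ (ρ + ρ * (θa + θb)) /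
      (m * (1 - θa) ^ 2 - (1 + Ct / s) * θa * (2 + θa) - (Fintype.card ι * μ ^ 2 / s + ν / a * Ct / s)
        - ((1 + μ * Real.sqrt (Fintype.card ι / s)) ^ 2 + Ct / s) * (θa + θb)) := by
  have hCts : 0 ≤ Ct / s := div_nonneg hCt hs.le
  -- plain Schur data of `t` from its moments (`e^{a d} ≥ 1`)
  have hone : ∀ x y, |t x y| ≤ |t x y| * Real.exp (a * d x y) := fun x y =>
    le_mul_of_one_le_right (abs_nonneg _) (Real.one_le_exp (mul_nonneg ha.le (hd x y)))
  have htrow0 : ∀ x, ∑ y, |t x y| ≤ Ct := fun x => (Finset.sum_le_sum fun y _ => hone x y).trans (htrow x)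
  have htcol0 : ∀ y, ∑ x, |t x y| ≤ Ct := fun y => (Finset.sum_le_sum fun x _ => hone x y).trans (htcol y)
  exact agmon_constrained_tangent_projector (latticeForm c e s₀ + kernelForm t) (mulOp ω)
    (mulOp (fun x => (ω x)⁻¹)) P T (energyNorm c e s) J (m := m) (Λ := 1 + Ct / s)
    (Λw := (1 + μ * Real.sqrt (Fintype.card ι / s)) ^ 2 + Ct / s)
    (κ := Fintype.card ι * μ ^ 2 / s + ν / a * Ct / s) (θa := θa) (θb := θb) (ρ := ρ)
    hden hm0 (by linarith) (by positivity) hθa0 hθa1 hθb0 hρ hcoerT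
    (fun v h => by
      rw [LinearMap.add_apply, LinearMap.add_apply]
      have h1 := latticeForm_abs_le_of_le c e hs₀ hs₀s v h
      have h2 := kernelForm_abs_le t hCt htrow0 htcol0 v h
      have h3 := mul_le_mul_of_nonneg_left (norm_mul_norm_le_energy c e hs v h) hCt
      have h4 := abs_add_le (latticeForm c e s₀ v h) (kernelForm t v h)
      have e1 : (1 + Ct / s) * energyNorm c e s v * energyNorm c e s h = energyNorm c e s v * energyNorm c e s h
          + Ct * (energyNorm c e s v * energyNorm c e s h / s) := by ring
      rw [e1]
      linarith)
    (energyNorm_sub_rev c e hs.le) (energyNorm_nonneg c e s)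
    (conjugationDefect_add _ _ _ _ (latticeForm_conjugationDefect_energy_of_le c e s₀ hs ω hω)
      (kernelForm_conjugationDefect_localized c e hs ω hpos d hd hdsym hν hνa ha hlog t hCt htrow htcol))
    (mulOp_inv_mul ω hpos) hPT hPr hda hdb hu
    (fun h => by
      rw [LinearMap.add_apply, LinearMap.add_apply]
      have h1 := latticeForm_weighted_continuity_of_le c e hs₀ hs₀s hs ω hpos hμ hω u h
      have h2 := kernelForm_weighted_abs_le c e hs ω hpos d hd hdsym hν hνa ha hlog t hCt htrow htcol u h
      have h4 := abs_add_le (latticeForm c e s₀ u h) (kernelForm t u h)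
      have e1 : ((1 + μ * Real.sqrt (Fintype.card ι / s)) ^ 2 + Ct / s) * energyNorm c e s (mulOp ω u) *
          energyNorm c e s (mulOp (fun x => (ω x)⁻¹) h) = (1 + μ * Real.sqrt (Fintype.card ι / s)) ^ 2 *
          (energyNorm c e s (mulOp ω u) * energyNorm c e s (mulOp (fun x => (ω x)⁻¹) h))
          + Ct / s * (energyNorm c e s (mulOp ω u) * energyNorm c e s (mulOp (fun x => (ω x)⁻¹) h)) := by
        ring
      rw [e1]
      linarith)
    (fun h => by
      have := hJ (mulOp (fun x => (ω x)⁻¹) h)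
      rwa [mulOp_mul_inv ω hpos] at this)
    hweak

/-- Non-vacuity of the smallness condition of `constrained_lattice_agmon_kernelTerm` in four directions:
`(s, μ, ν/a, C_t, θa, θb, m) = (1, 10⁻³, 10⁻³, 1/10, 1/20, 1/20, 1/2)`. -/
example : (4 : ℝ) * (1 / 1000) ^ 2 / 1 + (1 / 1000) * (1 / 10) / 1
    + ((1 + (1 / 1000) * Real.sqrt (4 / 1)) ^ 2 + (1 / 10) / 1) * (1 / 20 + 1 / 20)
    + (1 + (1 / 10) / 1) * (1 / 20) * (2 + 1 / 20) < (1 / 2) * (1 - 1 / 20) ^ 2 := by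
  have h4 : Real.sqrt (4 / 1) = 2 := by
    rw [div_one, show (4 : ℝ) = 2 ^ 2 by norm_num, Real.sqrt_sq (by norm_num)]
  rw [h4]
  norm_num

end KernelTerms

end Literature.MathematicalPhysics.QuantumFieldTheory.Balaban1983to89.T4ConstrainedAgmonD
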